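import Literature.NumberTheory.LFunctions.DedekindZetaClassicalRegionBounds
import Literature.NumberTheory.LFunctions.ClassicalPsiErrorTerm
import HarnessLib

/-!
# Logarithmic Riesz means of the coefficients of `H(s)/ζ_K(s)`: Perron's formula and the classical region

Topic `Literature/NumberTheory/LFunctions`, next to `DedekindZetaClassicalRegionBounds.lean`
(`1/ζ_K ≪ log(|t|+4)` in the classical zero-free region), `RieszMeanPerron.lean` /
`RieszMeanDirichlet.lean` (Perron's formula of order one) and `ClassicalPsiErrorTerm.lean`
(Landau's contour shift for `ψ`). Everything in this file is PROVED (theorems only; no definitions,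
no named facts).

The standard evaluation, by Perron's formula and the classical zero-free region of the Dedekind
zeta function, of sums of Möbius type over a number field `K` weighted by `log(x/n)`:
if `∑ a(n) n^{-s} = H(s)/ζ_K(s)` with `H(s) = ∑ h(n) n^{-s}` absolutely convergent on
`Re s ≥ σ_h` for some `σ_h < 1`, then
  `∑_{n ≤ x} (a(n)/n) log(x/n) = H(1)/ρ_K + O_{K,σ_h}(‖h‖ · exp(−c√(log x)))`,
`ρ_K = res_{s=1} ζ_K`, `‖h‖ = ∑ |h(n)| n^{-σ_h}` (`NumberField.logRieszMean_LSeries_div_dedekindZeta_bound`).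
This is, e.g., the step "the Perron formula shows that `Σ = (1/2πi)∫ f(s+1) x^s s^{-2} ds` …
using the standard zero-free region for `ζ_K(s)` we may change the path of integration in the
usual way to obtain `Σ = res{f(s+1)x^s s^{-2} : s = 0} + O(exp{−c√(log x)})`" of
D. R. Heath-Brown, *Primes represented by `x³ + 2y³`*, Acta Math. 186 (2001), p. 51 (the Möbius
sums (8.7) in the proof of Lemma 8.1, `f(s) = ∑_{(B,C)=1} μ(B)N(B)^{-s} = ζ_K(s)^{-1}∏_{P∣C}(1−N(P)^{-s})^{-1}`)
and pp. 62–63 (the singular-series sum `Σ₁ = ∑_{q<L} ρ₀(q)μ(q)q^{-1} log(L/q)`,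
`f(s) = ζ_K(s)^{-1} f₀(s)`, in the proof of Lemma 3.9), uniformly in the numerator `H`.

## Contents

* `LogRieszMean.*` — **Perron's formula for logarithmic Riesz means**: the Mellin pair
  `(−log y)𝟙_{(0,1]}(y) ↔ 1/s²` (`hasMellin_negLog_indicator`, `mellinInv_invSq_eq`) and
  `∑_{n ≤ x} f(n) log(x/n) = (1/2π)∫ x^{σ+it} L(f, σ+it) dt/(σ+it)²` for `∑|f(n)|n^{-σ} < ∞`, `σ > 0`
  (`sum_mul_log_eq_integral_LSeries`; Montgomery–Vaughan §5.1, (5.21)–(5.22) with `k = 1`).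
* `PerronShift.*` — **the contour shift** for an integrand `x^s Φ(s)` with `Φ` holomorphic on
  `−c/log(|t|+4) < σ < 1` and `‖Φ(s)‖ ≤ M log(|t|+4)/|s|²` (`σ ≥ −1/2`): Cauchy's theorem on the
  rectangle `[−c/(2log(T+4)), κ] × [−T, T]` (`integral_line_eq`) and the bound
  `‖∫ x^{κ+it}Φ(κ+it)dt‖ ≤ M(20x^κT^{−1/2} + 2x^κ log(T+4)/T² + (2π/c)log²(T+4)x^{−c/(2log(T+4))})`
  (`norm_integral_le`), following `ClassicalPsiErrorTerm.lean`.
* `NumberField.logRieszMean_eq_integral_add` — `∑_{n≤x}(a(n)/n)log(x/n) = (1/2π)∫x^{κ+it}Φ + Ψ(0)(1−1/x)⁺`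
  with `Ψ(s) = H(1+s)/ζ_K,₁(1+s)`, `Φ(s) = Ψ(s)/s − Ψ(0)/(s(s+1))` (the residue `Ψ(0) = H(1)/ρ_K`
  removed by the order-one kernel `RieszMean.integral_cpow_mul_kernel`).
* `NumberField.logRieszMean_LSeries_div_dedekindZeta_bound` — **the theorem** above, for every
  number field `K` and every `σ_h < 1`, with constants depending on `K`, `σ_h` only and the bound
  linear in `∑ |h(n)| n^{-σ_h}`; valid for all `x ≥ 1`.

## Proof sketch

`Ψ(s) = H(1+s)/ζ_K,₁(1+s)` (`ζ_K,₁(w) = (w−1)ζ_K(w)`, entire) is holomorphic on the translated region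
`−c/log(|t|+4) < σ < 1`, `c = min(c_K, 1 − σ_h, 1/2)`, with `|Ψ(s)| ≤ B C_K log(|t|+4)/|s|`
(`dedekindZeta₁_classicalRegion_bounds`) and `Ψ(0) = H(1)/ρ_K`; `Φ(s) = dslope Ψ 0 s + Ψ(0)/(s+1)`
is holomorphic there with `|Φ(s)| ≤ B(C_K + 1/ρ_K) log(|t|+4)/|s|²` for `σ ≥ −1/2`. For `x ≥ e⁴`
take `κ = 1/log x`, `T = exp(√log x)`; for `1 ≤ x < e⁴` take `κ = 1/2`, `T = 1`.

## References

* H. L. Montgomery, R. C. Vaughan, *Multiplicative Number Theory I. Classical Theory*, CUP 2007,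
  §5.1 (5.19)–(5.22); §6.2 Theorem 6.7, proof of Theorem 6.9. [cite: MontgomeryVaughan2007, §5.1 and §6.2]
* D. R. Heath-Brown, *Primes represented by `x³ + 2y³`*, Acta Math. 186 (2001), 1–84: §8 p. 51,
  §10 pp. 62–63. [cite: HeathBrownActa2001, §8 p. 51 and §10 pp. 62–63]
* E. Landau, *Neuer Beweis des Primzahlsatzes und Beweis des Primidealsatzes*, Math. Ann. 56
  (1903), §6. [cite: LandauMathAnn1903, §6]

## Mathlib / tree search

Mathlib: `mellin_hasDerivAt_of_isBigO_rpow`, `hasMellin_one_Ioc`, `mellinInv_mellin_eq`,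
`integral_boundary_rect_eq_zero_of_differentiableOn`, `Complex.differentiableOn_dslope`,
`LSeries_differentiableOn`, `LSeriesSummable.abscissaOfAbsConv_le`, `norm_term_le_of_re_le_re`,
`Measure.integral_comp_mul_left`, `integral_univ_inv_one_add_sq`, `NumberField.dedekindZeta`,
`NumberField.dedekindZeta_residue_pos`. Tree: `Literature.NumberTheory.LFunctions.mellinInv_kernel_eq`,
`RieszMean.integral_cpow_mul_kernel`, `RieszMean.sum_mul_sub_eq_integral_LSeries` (linear Riesz
means; the logarithmic kernel `1/s²` was missing: `lean search 'log.*Riesz|1 / s \^ 2|invSq'`),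
`ClassicalPsiData.log_tau_le_rpow`, `ClassicalZFRData.log_tau_pos`,
`NumberField.dedekindZeta₁_classicalRegion_bounds`, `NumberField.differentiable_dedekindZeta₁`,
`NumberField.dedekindZeta_ne_zero_of_one_lt_re`, `dedekindZetaCont_eq_dedekindZeta_holds`.
-/

noncomputable section

open Complex Filter Topology Set MeasureTheory Asymptotics Real intervalIntegral
open scoped Real Interval

namespace Literature.NumberTheory.LFunctions


namespace LogRieszMean

/-! ### The kernel `1/s²` on vertical lines -/

/-- `‖1/(σ + it)²‖ = 1/(σ² + t²)`. [folklore] -/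
theorem norm_inv_sq_eq (σ t : ℝ) : ‖1 / ((σ : ℂ) + t * I) ^ 2‖ = 1 / (σ ^ 2 + t ^ 2) := by
  have h : ‖(σ : ℂ) + t * I‖ ^ 2 = σ ^ 2 + t ^ 2 := by
    rw [Complex.sq_norm, Complex.normSq_apply]; simp; ring
  rw [norm_div, norm_one, norm_pow, h]

/-- `σ + it ≠ 0` for `σ > 0`. [folklore] -/
theorem line_ne_zero {σ : ℝ} (hσ : 0 < σ) (t : ℝ) : (σ : ℂ) + t * I ≠ 0 := by
  intro h
  have := congrArg Complex.re h
  simp at this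
  linarith

/-- The kernel `t ↦ 1/(σ + it)²` is integrable on `ℝ` for `σ > 0`. [folklore] -/
theorem integrable_inv_sq {σ : ℝ} (hσ : 0 < σ) :
    Integrable fun t : ℝ ↦ 1 / ((σ : ℂ) + t * I) ^ 2 := by
  refine (integrable_inv_sq_add_sq hσ).mono' ?_ (Eventually.of_forall fun t ↦ ?_)
  · refine Continuous.aestronglyMeasurable ?_
    exact Continuous.div continuous_const (by fun_prop) fun t ↦ pow_ne_zero _ (line_ne_zero hσ t)
  · exact (norm_inv_sq_eq σ t).le

/-! ### The Mellin pair `(−log y)·𝟙_{(0,1]} ↔ 1/s²` -/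

/-- The Mellin transform of `f(y) = (−log y)·𝟙_{(0,1]}(y)` is `1/s²` for `Re s > 0` (differentiate
the transform `1/s` of `𝟙_{(0,1]}`, Mathlib's `hasMellin_one_Ioc`, using
`mellin_hasDerivAt_of_isBigO_rpow`). [folklore] -/
theorem hasMellin_negLog_indicator {s : ℂ} (hs : 0 < s.re) :
    HasMellin ((Ioc 0 1).indicator fun y : ℝ ↦ (-(Real.log y) : ℂ)) s (1 / s ^ 2) := by
  set f : ℝ → ℂ := (Ioc 0 1).indicator fun _ ↦ (1 : ℂ) with hf
  have hfi : Integrable f := by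
    rw [hf, integrable_indicator_iff measurableSet_Ioc]
    exact integrableOn_const (by simp)
  have hfc : LocallyIntegrableOn f (Ioi 0) := hfi.locallyIntegrable.locallyIntegrableOn _
  have htop : f =O[atTop] (· ^ (-(s.re + 1))) := by
    have hev : f =ᶠ[atTop] (fun _ ↦ (0 : ℂ)) := by
      filter_upwards [eventually_gt_atTop 1] with t ht
      rw [hf, indicator_of_notMem (fun h ↦ absurd h.2 (not_le.2 ht))]
    exact (isBigO_zero _ _).congr' hev.symm EventuallyEq.rfl
  have hbot : f =O[𝓝[>] 0] (· ^ (-(0 : ℝ))) := by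
    refine IsBigO.of_bound 1 (Eventually.of_forall fun t ↦ ?_)
    rw [neg_zero, Real.rpow_zero, Real.norm_eq_abs, abs_one, mul_one, hf]
    by_cases ht : t ∈ Ioc (0 : ℝ) 1
    · simp [indicator_of_mem ht]
    · simp [indicator_of_notMem ht]
  obtain ⟨hconv, hder⟩ := mellin_hasDerivAt_of_isBigO_rpow hfc htop (by linarith) hbot hs
  have hopen : IsOpen {z : ℂ | 0 < z.re} := continuous_re.isOpen_preimage _ isOpen_Ioi
  have hev : mellin f =ᶠ[𝓝 s] fun z ↦ z⁻¹ := by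
    filter_upwards [hopen.mem_nhds hs] with z hz
    rw [(hasMellin_one_Ioc hz).2, one_div]
  have hs0 : s ≠ 0 := by rintro rfl; simp at hs
  have hder2 : HasDerivAt (fun z : ℂ ↦ z⁻¹) (mellin (fun t ↦ (Real.log t : ℂ) • f t) s) s :=
    hder.congr_of_eventuallyEq hev.symm
  have hval : mellin (fun t ↦ (Real.log t : ℂ) • f t) s = -(s ^ 2)⁻¹ :=
    hder2.unique (hasDerivAt_inv hs0)
  -- our function is `−(log • f)`
  have hfun : ((Ioc 0 1).indicator fun y : ℝ ↦ (-(Real.log y) : ℂ)) =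
      fun t ↦ (-1 : ℂ) • ((Real.log t : ℂ) • f t) := by
    funext t
    by_cases ht : t ∈ Ioc (0 : ℝ) 1
    · simp [hf, indicator_of_mem ht]
    · simp [hf, indicator_of_notMem ht]
  rw [hfun]
  refine ⟨hconv.const_smul (-1 : ℂ), ?_⟩
  rw [mellin_const_smul, hval]
  simp [one_div]

/-- **The Perron kernel for logarithmic Riesz means.** For `σ > 0` and `y > 0`,
`(1/2π) ∫_{−∞}^{∞} y^{−(σ+it)} dt/(σ+it)² = max(−log y, 0)`, i.e.
`(1/2πi) ∫_{(σ)} y^{−s} ds/s² = log⁺(1/y)` (Mellin inversion, Mathlib's `mellinInv_mellin_eq`).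
[cite: MontgomeryVaughan2007, §5.1 (5.21)] -/
theorem mellinInv_invSq_eq {σ : ℝ} (hσ : 0 < σ) {y : ℝ} (hy : 0 < y) :
    mellinInv σ (fun s ↦ 1 / s ^ 2) y = ((max (-Real.log y) 0 : ℝ) : ℂ) := by
  set f : ℝ → ℂ := (Ioc 0 1).indicator fun y : ℝ ↦ (-(Real.log y) : ℂ) with hf
  have hmel : ∀ t : ℝ, mellin f (σ + t * I) = 1 / ((σ : ℂ) + t * I) ^ 2 := fun t ↦
    (hasMellin_negLog_indicator (s := σ + t * I) (by simpa using hσ)).2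
  have hconv : MellinConvergent f σ :=
    (hasMellin_negLog_indicator (s := σ) (by simpa using hσ)).1
  have hvert : VerticalIntegrable (mellin f) σ := by
    unfold VerticalIntegrable
    exact (integrable_inv_sq hσ).congr (Eventually.of_forall fun t ↦ (hmel t).symm)
  have hfeq : ∀ u : ℝ, 0 < u → f u = ((max (-Real.log u) 0 : ℝ) : ℂ) := by
    intro u hu
    by_cases hu1 : u ≤ 1
    · rw [hf, indicator_of_mem (show u ∈ Ioc (0 : ℝ) 1 from ⟨hu, hu1⟩),
        max_eq_left (by linarith [Real.log_nonpos hu.le hu1])]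
      push_cast; ring
    · rw [hf, indicator_of_notMem (show u ∉ Ioc (0 : ℝ) 1 from fun h ↦ hu1 h.2),
        max_eq_right (by linarith [Real.log_nonneg (le_of_lt (not_le.1 hu1))])]
      simp
  have hcont : ContinuousAt f y := by
    have hev : f =ᶠ[𝓝 y] fun u ↦ ((max (-Real.log u) 0 : ℝ) : ℂ) := by
      filter_upwards [Ioi_mem_nhds hy] with u hu
      exact hfeq u hu
    refine ContinuousAt.congr ?_ hev.symm
    refine (Complex.continuous_ofReal.continuousAt).comp ?_
    exact ((Real.continuousAt_log hy.ne').neg.max continuousAt_const)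
  have hinv := mellinInv_mellin_eq σ f hy hconv hvert hcont
  rw [hfeq y hy] at hinv
  rw [← hinv]
  unfold mellinInv
  congr 1
  refine integral_congr_ae (Eventually.of_forall fun t ↦ ?_)
  simp only [hmel t]

/-! ### Perron's formula for `∑_{n ≤ x} f(n) log(x/n)` -/

/-- One term: for `x > 0`, `σ > 0`, `n ≥ 1`,
`f(n) log⁺(x/n) = (1/2π) ∫ x^{σ+it} f(n) n^{−(σ+it)} dt/(σ+it)²`. [folklore] -/
theorem apply_mul_logPosPart_eq_integral (f : ℕ → ℂ) {x : ℝ} (hx : 0 < x) {σ : ℝ} (hσ : 0 < σ)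
    {n : ℕ} (hn : n ≠ 0) :
    f n * ((max (Real.log (x / n)) 0 : ℝ) : ℂ) =
      (1 / (2 * π) : ℂ) * ∫ t : ℝ, (x : ℂ) ^ ((σ : ℂ) + t * I) *
        LSeries.term f (σ + t * I) n * (1 / ((σ : ℂ) + t * I) ^ 2) := by
  have hn0 : (0 : ℝ) < n := Nat.cast_pos.2 (Nat.pos_of_ne_zero hn)
  have hy : 0 < (n : ℝ) / x := div_pos hn0 hx
  have hK := mellinInv_invSq_eq hσ hy
  unfold mellinInv at hK
  have hlog : -Real.log ((n : ℝ) / x) = Real.log (x / n) := by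
    rw [← Real.log_inv, inv_div]
  rw [hlog] at hK
  rw [← hK, Complex.real_smul]
  have hx0 : (x : ℂ) ≠ 0 := ofReal_ne_zero.2 hx.ne'
  have hnC : (n : ℂ) ≠ 0 := Nat.cast_ne_zero.2 hn
  have hpt : ∀ t : ℝ, f n *
      (((n : ℂ) / (x : ℂ)) ^ (-((σ : ℂ) + t * I)) • (1 / (((σ : ℂ) + t * I)) ^ 2)) =
      (x : ℂ) ^ ((σ : ℂ) + t * I) * LSeries.term f (σ + t * I) n *
        (1 / ((σ : ℂ) + t * I) ^ 2) := by
    intro t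
    set s : ℂ := σ + t * I with hs
    simp only [smul_eq_mul]
    have hpow : ((n : ℂ) / (x : ℂ)) ^ (-s) = (x : ℂ) ^ s / (n : ℂ) ^ s := by
      rw [show (n : ℂ) / (x : ℂ) = (((n : ℝ) * x⁻¹ : ℝ) : ℂ) by push_cast; ring, cpow_neg,
        ofReal_mul, mul_cpow_ofReal_nonneg hn0.le (inv_nonneg.2 hx.le), ofReal_inv,
        inv_cpow _ _ ?_, mul_inv, inv_inv]
      · simp only [ofReal_natCast]; ring
      · rw [arg_ofReal_of_nonneg hx.le]; exact Real.pi_pos.ne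
    rw [hpow, LSeries.term_of_ne_zero hn]
    field_simp
  calc f n * ((((1 / (2 * π) : ℝ)) : ℂ) *
        ∫ t : ℝ, (((n : ℝ) / x : ℝ) : ℂ) ^ (-((σ : ℂ) + t * I)) •
          (fun s : ℂ ↦ 1 / s ^ 2) ((σ : ℂ) + t * I))
      = (((1 / (2 * π) : ℝ)) : ℂ) * ∫ t : ℝ, f n *
          ((((n : ℝ) / x : ℝ) : ℂ) ^ (-((σ : ℂ) + t * I)) •
            (fun s : ℂ ↦ 1 / s ^ 2) ((σ : ℂ) + t * I)) := by
        rw [MeasureTheory.integral_const_mul]; ring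
    _ = _ := by
        push_cast
        congr 1
        exact integral_congr_ae (Eventually.of_forall hpt)

/-- Norm of the `n`-th weighted term on `Re s = σ`: `x^{σ} ‖f(n) n^{-σ}‖`. [folklore] -/
theorem norm_cpow_mul_term (f : ℕ → ℂ) {x : ℝ} (hx : 0 < x) (σ t : ℝ) (n : ℕ) :
    ‖(x : ℂ) ^ ((σ : ℂ) + t * I) * LSeries.term f (σ + t * I) n‖ =
      x ^ σ * ‖LSeries.term f σ n‖ := by
  rw [norm_mul]
  congr 1
  · rw [norm_cpow_eq_rpow_re_of_pos hx]; simp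
  · rcases eq_or_ne n 0 with rfl | hn
    · simp [LSeries.term_zero]
    · rw [LSeries.norm_term_eq, LSeries.norm_term_eq]
      simp [hn]

/-- Continuity in `t` of the `n`-th weighted term `x^{σ+it} f(n) n^{-(σ+it)}`. [folklore] -/
theorem continuous_cpow_mul_term (f : ℕ → ℂ) {x : ℝ} (hx : 0 < x) (σ : ℝ) (n : ℕ) :
    Continuous fun t : ℝ ↦ (x : ℂ) ^ ((σ : ℂ) + t * I) * LSeries.term f (σ + t * I) n := by
  have hx0 : (x : ℂ) ≠ 0 := ofReal_ne_zero.2 hx.ne'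
  refine Continuous.mul ?_ ?_
  · refine continuous_iff_continuousAt.2 fun t ↦ ?_
    exact (continuousAt_const_cpow hx0).comp (f := fun t : ℝ ↦ ((σ : ℂ) + t * I))
      (by fun_prop)
  · rcases eq_or_ne n 0 with rfl | hn
    · simp only [LSeries.term_zero]; exact continuous_const
    · simp only [LSeries.term_of_ne_zero hn]
      refine continuous_const.div ?_ fun t ↦ ?_
      · refine continuous_iff_continuousAt.2 fun t ↦ ?_
        exact (continuousAt_const_cpow (Nat.cast_ne_zero.2 hn)).comp
          (f := fun t : ℝ ↦ ((σ : ℂ) + t * I)) (by fun_prop)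
      · exact cpow_ne_zero_iff.2 (Or.inl (Nat.cast_ne_zero.2 hn))

/-- Integrability of `t ↦ x^{σ+it} L(f, σ+it)/(σ+it)²` when `∑ |f(n)| n^{-σ} < ∞`, `σ > 0`, and the
bound `‖x^{s} L(f,s)‖ ≤ x^σ ∑ ‖f(n) n^{-σ}‖` on the line. [folklore] -/
theorem integrable_cpow_mul_LSeries_mul_invSq (f : ℕ → ℂ) {x : ℝ} (hx : 0 < x) {σ : ℝ}
    (hσ : 0 < σ) (hsum : LSeriesSummable f σ) :
    Integrable fun t : ℝ ↦ (x : ℂ) ^ ((σ : ℂ) + t * I) * LSeries f (σ + t * I) *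
      (1 / ((σ : ℂ) + t * I) ^ 2) := by
  set u : ℕ → ℝ := fun n ↦ x ^ σ * ‖LSeries.term f σ n‖ with hu
  have hsu : Summable u := (hsum.norm).mul_left _
  set G : ℕ → ℝ → ℂ := fun n t ↦ (x : ℂ) ^ ((σ : ℂ) + t * I) * LSeries.term f (σ + t * I) n
  have hGc : ∀ n, Continuous (G n) := fun n ↦ continuous_cpow_mul_term f hx σ n
  have hGn : ∀ n t, ‖G n t‖ ≤ u n := fun n t ↦ (norm_cpow_mul_term f hx σ t n).le
  have hcont : Continuous fun t ↦ ∑' n, G n t := continuous_tsum hGc hsu hGn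
  have heq : ∀ t : ℝ, (x : ℂ) ^ ((σ : ℂ) + t * I) * LSeries f (σ + t * I) = ∑' n, G n t := by
    intro t
    rw [LSeries, ← tsum_mul_left]
  have hbd : ∀ t : ℝ, ‖(x : ℂ) ^ ((σ : ℂ) + t * I) * LSeries f (σ + t * I)‖ ≤ ∑' n, u n := by
    intro t
    rw [heq t]
    exact tsum_of_norm_bounded hsu.hasSum (hGn · t)
  refine (integrable_inv_sq hσ).bdd_mul (c := ∑' n, u n) ?_ (Eventually.of_forall hbd)
  exact (hcont.congr fun t ↦ (heq t).symm).aestronglyMeasurable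

/-- **Perron's formula for logarithmic Riesz means** (Montgomery–Vaughan (5.21)–(5.22) with
`k = 1` in the variable `log`): if `∑ f(n) n^{-σ}` converges absolutely, `σ > 0`, then for every
`x > 0`, `∑_{n ≤ x} f(n) log(x/n) = (1/2π) ∫_{−∞}^{∞} x^{s} L(f, s) dt/s²`, `s = σ + it`, the
integral converging absolutely. [cite: MontgomeryVaughan2007, §5.1 (5.21)] -/
theorem sum_mul_log_eq_integral_LSeries (f : ℕ → ℂ) {x : ℝ} (hx : 0 < x) {σ : ℝ} (hσ : 0 < σ)
    (hsum : LSeriesSummable f σ) :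
    ∑ n ∈ Finset.Ioc 0 ⌊x⌋₊, f n * (Real.log (x / n) : ℂ) =
      (1 / (2 * π) : ℂ) * ∫ t : ℝ, (x : ℂ) ^ ((σ : ℂ) + t * I) *
        LSeries f (σ + t * I) * (1 / ((σ : ℂ) + t * I) ^ 2) := by
  set K : ℝ → ℂ := fun t ↦ 1 / ((σ : ℂ) + t * I) ^ 2 with hK
  set G : ℕ → ℝ → ℂ := fun n t ↦ (x : ℂ) ^ ((σ : ℂ) + t * I) * LSeries.term f (σ + t * I) n
    with hG
  set F : ℕ → ℝ → ℂ := fun n t ↦ G n t * K t with hF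
  have hnormG : ∀ n t, ‖G n t‖ = x ^ σ * ‖LSeries.term f σ n‖ := fun n t ↦
    norm_cpow_mul_term f hx σ t n
  have hcontG : ∀ n, Continuous (G n) := fun n ↦ continuous_cpow_mul_term f hx σ n
  have hintK : Integrable K := integrable_inv_sq hσ
  have hintF : ∀ n, Integrable (F n) := fun n ↦
    hintK.bdd_mul (hcontG n).aestronglyMeasurable (Eventually.of_forall fun t ↦ (hnormG n t).le)
  have hsumF : Summable fun n ↦ ∫ t, ‖F n t‖ := by
    have hS : Summable fun n ↦ ‖LSeries.term f σ n‖ := hsum.norm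
    have := (hS.mul_left (x ^ σ)).mul_right (∫ t : ℝ, ‖K t‖)
    refine this.congr fun n ↦ ?_
    rw [← MeasureTheory.integral_const_mul]
    refine integral_congr_ae (Eventually.of_forall fun t ↦ ?_)
    simp only [hF, norm_mul, hnormG n t]
  set g : ℕ → ℂ := fun n ↦ if n = 0 then 0 else f n * ((max (Real.log (x / n)) 0 : ℝ) : ℂ)
    with hg
  have hterm : ∀ n : ℕ, g n = (1 / (2 * π) : ℂ) * ∫ t, F n t := by
    intro n
    rcases eq_or_ne n 0 with rfl | hn
    · simp [hg, hF, hG, LSeries.term_zero]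
    · simp only [hg, if_neg hn]
      exact apply_mul_logPosPart_eq_integral f hx hσ hn
  have hlhs : ∑ n ∈ Finset.Ioc 0 ⌊x⌋₊, f n * (Real.log (x / n) : ℂ) = ∑' n : ℕ, g n := by
    rw [tsum_eq_sum (s := Finset.Ioc 0 ⌊x⌋₊)]
    · refine Finset.sum_congr rfl fun n hn ↦ ?_
      rw [Finset.mem_Ioc] at hn
      have hn0 : (0 : ℝ) < n := Nat.cast_pos.2 hn.1
      have hnx : (n : ℝ) ≤ x := (Nat.cast_le.2 hn.2).trans (Nat.floor_le hx.le)
      have hlog : 0 ≤ Real.log (x / n) := Real.log_nonneg ((one_le_div hn0).2 hnx)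
      simp only [hg, if_neg hn.1.ne', max_eq_left hlog]
    · intro n hn
      rw [Finset.mem_Ioc, not_and_or, not_lt, not_le] at hn
      rcases hn with hn | hn
      · simp [hg, Nat.le_zero.1 hn]
      · have hxn : x < n := by
          have := Nat.lt_of_floor_lt hn
          exact_mod_cast this
        have hn0' : n ≠ 0 := by rintro rfl; simp at hn
        have hn0 : (0 : ℝ) < n := Nat.cast_pos.2 (Nat.pos_of_ne_zero hn0')
        have hlog : Real.log (x / n) ≤ 0 :=
          Real.log_nonpos (div_pos hx hn0).le ((div_le_one hn0).2 hxn.le)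
        simp only [hg, if_neg hn0', max_eq_right hlog]
        simp
  rw [hlhs, tsum_congr hterm, tsum_mul_left, integral_tsum_of_summable_integral_norm hintF hsumF]
  congr 1
  refine integral_congr_ae (Eventually.of_forall fun t ↦ ?_)
  simp only [hF, hG, hK]
  rw [LSeries, ← tsum_mul_left, ← tsum_mul_right]

end LogRieszMean



namespace PerronShift

/-- Local notation for the translated classical region `−c/log(|t|+4) < σ < 1` (the region
`1 − c/log(|t|+4) < σ < 2` of `ClassicalZFRData`/`ClassicalPsiData`, shifted by `1`). -/
local notation3 "Rg[" c "]" => {s : ℂ | -c / Real.log (|s.im| + 4) < s.re ∧ s.re < 1}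

/-! ### The region -/

/-- The region is open. [folklore] -/
theorem isOpen_region (c : ℝ) : IsOpen Rg[c] := by
  have h1 : Continuous fun s : ℂ ↦ Real.log (|s.im| + 4) :=
    ((continuous_abs.comp continuous_im).add continuous_const).log
      fun s ↦ (by positivity : (0 : ℝ) < |s.im| + 4).ne'
  have h2 : Continuous fun s : ℂ ↦ -c / Real.log (|s.im| + 4) :=
    continuous_const.div h1 fun s ↦ (ClassicalZFRData.log_tau_pos _).ne'
  exact (isOpen_lt h2 continuous_re).inter (isOpen_lt continuous_re continuous_const)

/-- `0` lies in the region (`c > 0`). [folklore] -/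
theorem zero_mem_region {c : ℝ} (hc : 0 < c) : (0 : ℂ) ∈ Rg[c] := by
  refine ⟨?_, by simp⟩
  simp only [zero_im, abs_zero, zero_add, zero_re]
  exact div_neg_of_neg_of_pos (by linarith) (Real.log_pos (by norm_num))

/-- Points with `0 ≤ σ < 1` lie in the region (`c > 0`). [folklore] -/
theorem mem_region_of_nonneg {c : ℝ} (hc : 0 < c) {s : ℂ} (h0 : 0 ≤ s.re) (h1 : s.re < 1) :
    s ∈ Rg[c] := by
  refine ⟨?_, h1⟩
  have : 0 < c / Real.log (|s.im| + 4) := div_pos hc (ClassicalZFRData.log_tau_pos _)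
  rw [neg_div]; linarith

/-- The closed rectangle `[−c/(2 log(T+4)), 1) × [−T, T]` lies in the region. [folklore] -/
theorem mem_region_of_rect {c T : ℝ} (hc : 0 < c) {s : ℂ}
    (hre : -(c / (2 * Real.log (T + 4))) ≤ s.re) (hre1 : s.re < 1) (him : |s.im| ≤ T) :
    s ∈ Rg[c] := by
  refine ⟨?_, hre1⟩
  have hℓ0 : 0 < Real.log (|s.im| + 4) := ClassicalZFRData.log_tau_pos _
  have hℓT : Real.log (|s.im| + 4) ≤ Real.log (T + 4) :=
    Real.log_le_log (by positivity) (by linarith)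
  have hℓT0 : 0 < Real.log (T + 4) := hℓ0.trans_le hℓT
  have h1 : c / (2 * Real.log (T + 4)) < c / Real.log (T + 4) := by
    rw [div_lt_div_iff_of_pos_left hc (by linarith) hℓT0]; linarith
  have h2 : c / Real.log (T + 4) ≤ c / Real.log (|s.im| + 4) :=
    div_le_div_of_nonneg_left hc.le hℓ0 hℓT
  rw [neg_div]; linarith

/-! ### The kernel `1/(σ² + t²)` -/

/-- `∫_{−∞}^{∞} dt/(σ² + t²) = π/σ` for `σ > 0`. [folklore] -/
theorem integral_inv_sq_add_sq {σ : ℝ} (hσ : 0 < σ) : ∫ t : ℝ, 1 / (σ ^ 2 + t ^ 2) = π / σ := by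
  have h := Measure.integral_comp_mul_left (fun u : ℝ ↦ (1 + u ^ 2)⁻¹) σ⁻¹
  rw [inv_inv, abs_of_pos hσ, integral_univ_inv_one_add_sq, smul_eq_mul] at h
  have heq : (fun t : ℝ ↦ 1 / (σ ^ 2 + t ^ 2)) = fun t ↦ (σ ^ 2)⁻¹ * (1 + (σ⁻¹ * t) ^ 2)⁻¹ := by
    funext t
    rw [← mul_inv, one_div]
    congr 1
    field_simp
  rw [heq, MeasureTheory.integral_const_mul, h]
  field_simp

/-! ### Cauchy's theorem on the rectangle `[−σ₁, κ] × [−T, T]` -/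

/-- **Moving the segment `[κ − iT, κ + iT]` to `Re s = −σ₁`**: if `Θ` is holomorphic on the
region and integrable on `Re s = κ`, then its line integral equals the two tails, plus the
integral over the left side `Re s = −σ₁` (`σ₁ ≤ c/(2 log(T+4))`), plus `i` times (bottom minus top)
(Cauchy–Goursat, Mathlib's `integral_boundary_rect_eq_zero_of_differentiableOn`).
[cite: LandauMathAnn1903, §6] -/
theorem integral_line_eq {Θ : ℂ → ℂ} {c : ℝ} (hc : 0 < c) (hΘ : DifferentiableOn ℂ Θ Rg[c])
    {κ σ₁ T : ℝ} (hT : 0 < T) (hκ1 : κ < 1) (hσ₁κ : -σ₁ ≤ κ)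
    (hσ₁ : σ₁ ≤ c / (2 * Real.log (T + 4)))
    (hint : Integrable fun t : ℝ ↦ Θ (κ + t * I)) :
    ∫ t : ℝ, Θ (κ + t * I) =
      (∫ t in Iic (-T), Θ (κ + t * I)) + (∫ t in Ioi T, Θ (κ + t * I)) +
      (∫ t in (-T)..T, Θ (((-σ₁ : ℝ) : ℂ) + t * I)) +
      I * (∫ u in (-σ₁)..κ, Θ (u + (-T) * I)) - I * (∫ u in (-σ₁)..κ, Θ (u + T * I)) := by
  have hsplit1 := integral_Iic_add_Ioi (b := -T) hint.integrableOn hint.integrableOn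
  have hsplit2 := integral_interval_add_Ioi (a := -T) (b := T) hint.integrableOn hint.integrableOn
  have hdiff : DifferentiableOn ℂ Θ (uIcc (-σ₁) κ ×ℂ uIcc (-T) T) := by
    intro s hs
    rw [uIcc_of_le hσ₁κ, uIcc_of_le (by linarith : -T ≤ T)] at hs
    obtain ⟨⟨hre1, hre2⟩, him1, him2⟩ := hs
    have hsz : s ∈ Rg[c] := mem_region_of_rect hc (by linarith) (by linarith)
      (abs_le.2 ⟨him1, him2⟩)
    exact (hΘ.differentiableAt ((isOpen_region c).mem_nhds hsz)).differentiableWithinAt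
  have H := Complex.integral_boundary_rect_eq_zero_of_differentiableOn Θ ⟨-σ₁, -T⟩ ⟨κ, T⟩ hdiff
  dsimp only at H
  simp only [smul_eq_mul, ofReal_neg, neg_mul] at H ⊢
  have key : (∫ y : ℝ in (-T)..T, Θ (κ + y * I)) =
      (∫ y : ℝ in (-T)..T, Θ (-(σ₁ : ℂ) + y * I)) +
        I * (∫ u : ℝ in (-σ₁)..κ, Θ (u + -(T * I))) -
        I * (∫ u : ℝ in (-σ₁)..κ, Θ (u + T * I)) := by
    have hI : I * I = -1 := I_mul_I
    linear_combination (-I) * H +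
      ((∫ y : ℝ in (-T)..T, Θ (κ + y * I)) -
        (∫ y : ℝ in (-T)..T, Θ (-(σ₁ : ℂ) + y * I))) * hI
  rw [← hsplit1, ← hsplit2, key]
  ring

/-! ### Bounds for the five pieces -/

section Pieces

variable {Θ Φ : ℂ → ℂ} {c M x : ℝ}

/-- **Pointwise bound on the line `Re s = κ ∈ (0, 1/2]` for `|t| ≥ 1`**:
`‖x^{s} Φ(s)‖ ≤ 5 M x^{κ} |t|^{−3/2}` (`x ≥ 1`), from `‖Φ(s)‖ ≤ M log(|t|+4)/‖s‖²` and
`log(|t|+4) ≤ 5|t|^{1/2}`. [folklore] -/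
theorem norm_le_tail (hc : 0 < c) (hM : 0 ≤ M) (hx : 1 ≤ x)
    (hΘ : ∀ s, Θ s = (x : ℂ) ^ s * Φ s)
    (hΦb : ∀ s ∈ Rg[c], s ≠ 0 → -1 / 2 ≤ s.re → ‖Φ s‖ ≤ M * Real.log (|s.im| + 4) / ‖s‖ ^ 2)
    {κ : ℝ} (hκ0 : 0 < κ) (hκ : κ ≤ 1 / 2) {t : ℝ} (ht : 1 ≤ |t|) :
    ‖Θ (κ + t * I)‖ ≤ 5 * M * x ^ κ * |t| ^ (-(3 / 2 : ℝ)) := by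
  have hx0 : 0 < x := by linarith
  have ht0 : 0 < |t| := by linarith
  set s : ℂ := κ + t * I with hsdef
  have hre : s.re = κ := by simp [hsdef]
  have him : s.im = t := by simp [hsdef]
  have hmem : s ∈ Rg[c] := mem_region_of_nonneg hc (by rw [hre]; exact hκ0.le) (by rw [hre]; linarith)
  have hs0 : s ≠ 0 := fun h ↦ by have := congrArg Complex.re h; rw [hre] at this; simp at this; linarith
  have hΦ := hΦb s hmem hs0 (by rw [hre]; linarith)
  rw [him] at hΦ
  have hnorm2 : t ^ 2 ≤ ‖s‖ ^ 2 := by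
    have h : ‖s‖ ^ 2 = κ ^ 2 + t ^ 2 := by
      rw [hsdef, Complex.sq_norm, Complex.normSq_apply]; simp; ring
    rw [h]; nlinarith
  have ht2 : 0 < t ^ 2 := by rw [← sq_abs]; positivity
  have hΦ' : ‖Φ s‖ ≤ M * (5 * |t| ^ (1 / 2 : ℝ)) / t ^ 2 := by
    refine hΦ.trans ?_
    have hlog := ClassicalPsiData.log_tau_le_rpow ht
    calc M * Real.log (|t| + 4) / ‖s‖ ^ 2 ≤ M * (5 * |t| ^ (1 / 2 : ℝ)) / ‖s‖ ^ 2 := by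
          gcongr
      _ ≤ M * (5 * |t| ^ (1 / 2 : ℝ)) / t ^ 2 := by
          apply div_le_div_of_nonneg_left (by positivity) ht2 hnorm2
  rw [hΘ s, norm_mul, norm_cpow_eq_rpow_re_of_pos hx0, hre]
  have hsplit : |t| ^ (-(3 / 2 : ℝ)) = |t| ^ (1 / 2 : ℝ) / t ^ 2 := by
    rw [← sq_abs, show (-(3 / 2 : ℝ)) = 1 / 2 - 2 by norm_num, Real.rpow_sub ht0,
      Real.rpow_two]
  calc x ^ κ * ‖Φ s‖ ≤ x ^ κ * (M * (5 * |t| ^ (1 / 2 : ℝ)) / t ^ 2) := by gcongr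
    _ = 5 * M * x ^ κ * |t| ^ (-(3 / 2 : ℝ)) := by rw [hsplit]; ring

/-- **The upper tail**: `‖∫_T^∞ x^{s}Φ(s) dt‖ ≤ 10 M x^{κ} T^{−1/2}` (`Re s = κ`, `T ≥ 1`).
[cite: LandauMathAnn1903, §6] -/
theorem norm_integral_Ioi_le (hc : 0 < c) (hM : 0 ≤ M) (hx : 1 ≤ x)
    (hΘ : ∀ s, Θ s = (x : ℂ) ^ s * Φ s)
    (hΦb : ∀ s ∈ Rg[c], s ≠ 0 → -1 / 2 ≤ s.re → ‖Φ s‖ ≤ M * Real.log (|s.im| + 4) / ‖s‖ ^ 2)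
    {κ : ℝ} (hκ0 : 0 < κ) (hκ : κ ≤ 1 / 2) {T : ℝ} (hT : 1 ≤ T) :
    ‖∫ t in Ioi T, Θ (κ + t * I)‖ ≤ 10 * M * x ^ κ * T ^ (-(1 / 2 : ℝ)) := by
  have hT0 : 0 < T := by linarith
  set g : ℝ → ℝ := fun t ↦ 5 * M * x ^ κ * t ^ (-(3 / 2 : ℝ)) with hg
  have hgi : IntegrableOn g (Ioi T) :=
    (integrableOn_Ioi_rpow_of_lt (by norm_num : (-(3 / 2 : ℝ)) < -1) hT0).const_mul _
  have hbound : ∀ᵐ t : ℝ ∂(volume.restrict (Ioi T)), ‖Θ (κ + t * I)‖ ≤ g t := by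
    refine (ae_restrict_iff' measurableSet_Ioi).2 (Eventually.of_forall fun t (ht : T < t) ↦ ?_)
    have ht1 : 1 ≤ |t| := by rw [abs_of_pos (hT0.trans ht)]; linarith
    have := norm_le_tail hc hM hx hΘ hΦb hκ0 hκ ht1
    rwa [abs_of_pos (hT0.trans ht)] at this
  refine (norm_integral_le_of_norm_le hgi hbound).trans (le_of_eq ?_)
  rw [hg, MeasureTheory.integral_const_mul, integral_Ioi_rpow_of_lt (by norm_num) hT0]
  have : (-(3 / 2 : ℝ)) + 1 = -(1 / 2 : ℝ) := by norm_num
  rw [this]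
  ring

/-- **The lower tail** (reflect `t ↦ −t`). [cite: LandauMathAnn1903, §6] -/
theorem norm_integral_Iic_le (hc : 0 < c) (hM : 0 ≤ M) (hx : 1 ≤ x)
    (hΘ : ∀ s, Θ s = (x : ℂ) ^ s * Φ s)
    (hΦb : ∀ s ∈ Rg[c], s ≠ 0 → -1 / 2 ≤ s.re → ‖Φ s‖ ≤ M * Real.log (|s.im| + 4) / ‖s‖ ^ 2)
    {κ : ℝ} (hκ0 : 0 < κ) (hκ : κ ≤ 1 / 2) {T : ℝ} (hT : 1 ≤ T) :
    ‖∫ t in Iic (-T), Θ (κ + t * I)‖ ≤ 10 * M * x ^ κ * T ^ (-(1 / 2 : ℝ)) := by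
  have hT0 : 0 < T := by linarith
  rw [← integral_comp_neg_Ioi]
  set g : ℝ → ℝ := fun t ↦ 5 * M * x ^ κ * t ^ (-(3 / 2 : ℝ)) with hg
  have hgi : IntegrableOn g (Ioi T) :=
    (integrableOn_Ioi_rpow_of_lt (by norm_num : (-(3 / 2 : ℝ)) < -1) hT0).const_mul _
  have hbound : ∀ᵐ t : ℝ ∂(volume.restrict (Ioi T)),
      ‖Θ (κ + ((-t : ℝ) : ℂ) * I)‖ ≤ g t := by
    refine (ae_restrict_iff' measurableSet_Ioi).2 (Eventually.of_forall fun t (ht : T < t) ↦ ?_)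
    have ht1 : 1 ≤ |(-t)| := by rw [abs_neg, abs_of_pos (hT0.trans ht)]; linarith
    have := norm_le_tail hc hM hx hΘ hΦb hκ0 hκ ht1
    rwa [abs_neg, abs_of_pos (hT0.trans ht)] at this
  refine (norm_integral_le_of_norm_le hgi hbound).trans (le_of_eq ?_)
  rw [hg, MeasureTheory.integral_const_mul, integral_Ioi_rpow_of_lt (by norm_num) hT0]
  have : (-(3 / 2 : ℝ)) + 1 = -(1 / 2 : ℝ) := by norm_num
  rw [this]
  ring

/-- **The horizontal sides** `[−σ₁, κ] × {±T}`:
`‖∫_{−σ₁}^{κ} x^{u ± iT} Φ(u ± iT) du‖ ≤ M log(T+4) x^{κ} (κ + σ₁)/T²`. [cite: LandauMathAnn1903, §6] -/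
theorem norm_integral_horizontal_le (hc : 0 < c) (hM : 0 ≤ M) (hx : 1 ≤ x)
    (hΘ : ∀ s, Θ s = (x : ℂ) ^ s * Φ s)
    (hΦb : ∀ s ∈ Rg[c], s ≠ 0 → -1 / 2 ≤ s.re → ‖Φ s‖ ≤ M * Real.log (|s.im| + 4) / ‖s‖ ^ 2)
    {κ σ₁ T : ℝ} (hκ1 : κ < 1) (hT : 1 ≤ T) (hσ₁κ : -σ₁ ≤ κ) (hσ₁h : σ₁ ≤ 1 / 2)
    (hσ₁ : σ₁ ≤ c / (2 * Real.log (T + 4))) {T' : ℝ} (hT' : |T'| = T) :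
    ‖∫ u in (-σ₁)..κ, Θ (u + T' * I)‖ ≤
      M * Real.log (T + 4) * x ^ κ / T ^ 2 * (κ + σ₁) := by
  have hx0 : 0 < x := by linarith
  have hT0 : 0 < T := by linarith
  have hT'0 : T' ≠ 0 := by rintro rfl; simp at hT'; linarith
  have hb : ∀ u ∈ Ι (-σ₁) κ, ‖Θ (u + T' * I)‖ ≤ M * Real.log (T + 4) * x ^ κ / T ^ 2 := by
    intro u hu
    rw [uIoc_of_le hσ₁κ] at hu
    set s : ℂ := u + T' * I with hsdef
    have him : s.im = T' := by simp [hsdef]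
    have hre : s.re = u := by simp [hsdef]
    have hmem : s ∈ Rg[c] := mem_region_of_rect hc (by rw [hre]; linarith [hu.1])
      (by rw [hre]; linarith [hu.2]) (by rw [him, hT'])
    have hs0 : s ≠ 0 := fun h ↦ by
      have := congrArg Complex.im h; rw [him] at this; simp at this; exact hT'0 this
    have hΦ := hΦb s hmem hs0 (by rw [hre]; linarith [hu.1])
    rw [him, hT'] at hΦ
    have hnorm2 : T ^ 2 ≤ ‖s‖ ^ 2 := by
      have h : ‖s‖ ^ 2 = u ^ 2 + T' ^ 2 := by
        rw [hsdef, Complex.sq_norm, Complex.normSq_apply]; simp; ring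
      rw [h, ← hT', sq_abs]; nlinarith
    have hlog : 0 ≤ Real.log (T + 4) := Real.log_nonneg (by linarith)
    have hΦ' : ‖Φ s‖ ≤ M * Real.log (T + 4) / T ^ 2 :=
      hΦ.trans (div_le_div_of_nonneg_left (mul_nonneg hM hlog) (by positivity) hnorm2)
    have hxu : x ^ u ≤ x ^ κ := Real.rpow_le_rpow_of_exponent_le hx hu.2
    rw [hΘ s, norm_mul, norm_cpow_eq_rpow_re_of_pos hx0, hre]
    calc x ^ u * ‖Φ s‖ ≤ x ^ κ * (M * Real.log (T + 4) / T ^ 2) := by gcongr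
      _ = M * Real.log (T + 4) * x ^ κ / T ^ 2 := by ring
  have := intervalIntegral.norm_integral_le_of_norm_le_const hb
  rwa [show κ - -σ₁ = κ + σ₁ by ring, abs_of_nonneg (by linarith : 0 ≤ κ + σ₁)] at this

/-- **The left side** `Re s = −σ₁`, `σ₁ = c/(2 log(T+4))`:
`‖∫_{−T}^{T} x^{−σ₁+it}Φ(−σ₁+it) dt‖ ≤ M log(T+4) x^{−σ₁} π/σ₁` (using `∫ dt/(σ₁²+t²) = π/σ₁`).
[cite: LandauMathAnn1903, §6] -/
theorem norm_integral_left_le (hc : 0 < c) (hM : 0 ≤ M) (hx : 1 ≤ x)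
    (hΘ : ∀ s, Θ s = (x : ℂ) ^ s * Φ s)
    (hΦb : ∀ s ∈ Rg[c], s ≠ 0 → -1 / 2 ≤ s.re → ‖Φ s‖ ≤ M * Real.log (|s.im| + 4) / ‖s‖ ^ 2)
    {σ₁ T : ℝ} (hT : 1 ≤ T) (hσ₁0 : 0 < σ₁) (hσ₁h : σ₁ ≤ 1 / 2)
    (hσ₁ : σ₁ ≤ c / (2 * Real.log (T + 4))) :
    ‖∫ t in (-T)..T, Θ (((-σ₁ : ℝ) : ℂ) + t * I)‖ ≤
      M * Real.log (T + 4) * x ^ (-σ₁) * (π / σ₁) := by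
  have hx0 : 0 < x := by linarith
  have hT0 : 0 < T := by linarith
  have hlog : 0 ≤ Real.log (T + 4) := Real.log_nonneg (by linarith)
  set A : ℝ := M * Real.log (T + 4) * x ^ (-σ₁) with hA
  have hA0 : 0 ≤ A := by positivity
  set g : ℝ → ℝ := fun t ↦ A * (1 / (σ₁ ^ 2 + t ^ 2)) with hg
  have hgi : Integrable g := (integrable_inv_sq_add_sq hσ₁0).const_mul A
  have hb : ∀ᵐ t : ℝ, t ∈ Ioc (-T) T → ‖Θ (((-σ₁ : ℝ) : ℂ) + t * I)‖ ≤ g t := by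
    refine Eventually.of_forall fun t ht ↦ ?_
    set s : ℂ := ((-σ₁ : ℝ) : ℂ) + t * I with hsdef
    have him : s.im = t := by simp [hsdef]
    have hre : s.re = -σ₁ := by simp [hsdef]
    have htT : |t| ≤ T := abs_le.2 ⟨ht.1.le, ht.2⟩
    have hmem : s ∈ Rg[c] := mem_region_of_rect hc (by rw [hre]; linarith)
      (by rw [hre]; linarith) (by rw [him]; exact htT)
    have hs0 : s ≠ 0 := fun h ↦ by
      have := congrArg Complex.re h; rw [hre] at this; simp at this; linarith
    have hΦ := hΦb s hmem hs0 (by rw [hre]; linarith)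
    rw [him] at hΦ
    have hnorm2 : ‖s‖ ^ 2 = σ₁ ^ 2 + t ^ 2 := by
      rw [hsdef, Complex.sq_norm, Complex.normSq_apply]; simp; ring
    have hpos : 0 < σ₁ ^ 2 + t ^ 2 := by positivity
    have hℓ : Real.log (|t| + 4) ≤ Real.log (T + 4) :=
      Real.log_le_log (by positivity) (by linarith)
    have hΦ' : ‖Φ s‖ ≤ M * Real.log (T + 4) / (σ₁ ^ 2 + t ^ 2) := by
      calc ‖Φ s‖ ≤ M * Real.log (|t| + 4) / ‖s‖ ^ 2 := hΦ
        _ ≤ M * Real.log (T + 4) / ‖s‖ ^ 2 := by gcongr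
        _ = M * Real.log (T + 4) / (σ₁ ^ 2 + t ^ 2) := by rw [hnorm2]
    rw [hΘ s, norm_mul, norm_cpow_eq_rpow_re_of_pos hx0, hre, hg]
    calc x ^ (-σ₁) * ‖Φ s‖ ≤ x ^ (-σ₁) * (M * Real.log (T + 4) / (σ₁ ^ 2 + t ^ 2)) := by
          gcongr
      _ = A * (1 / (σ₁ ^ 2 + t ^ 2)) := by rw [hA]; ring
  have h1 := intervalIntegral.norm_integral_le_of_norm_le (by linarith : -T ≤ T) hb
    (hgi.intervalIntegrable)
  refine h1.trans ?_
  rw [intervalIntegral.integral_of_le (by linarith : -T ≤ T)]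
  calc ∫ t in Ioc (-T) T, g t ≤ ∫ t, g t :=
        setIntegral_le_integral hgi (Eventually.of_forall fun t ↦ by simp only [hg]; positivity)
    _ = A * (π / σ₁) := by rw [hg, MeasureTheory.integral_const_mul, integral_inv_sq_add_sq hσ₁0]

/-- **The shifted-contour bound** (Landau's method, MV §6.2, for an integrand `x^s Φ(s)` with
`Φ` holomorphic on `−c/log(|t|+4) < σ < 1` and `‖Φ(s)‖ ≤ M log(|t|+4)/|s|²` there for
`σ ≥ −1/2`, `s ≠ 0`): for `x ≥ 1`, `0 < κ ≤ 1/2`, `T ≥ 1` and `0 < c ≤ 1/2`,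
`‖∫_{−∞}^{∞} x^{κ+it} Φ(κ+it) dt‖ ≤ M (20 x^κ T^{−1/2} + 2 x^κ log(T+4)/T² + (2π/c) log²(T+4) x^{−c/(2 log(T+4))})`.
[cite: MontgomeryVaughan2007, §6.2 (proof of Theorem 6.9)] -/
theorem norm_integral_le (hc : 0 < c) (hc2 : c ≤ 1 / 2) (hM : 0 ≤ M) (hx : 1 ≤ x)
    (hΘ : ∀ s, Θ s = (x : ℂ) ^ s * Φ s) (hΦd : DifferentiableOn ℂ Φ Rg[c])
    (hΦb : ∀ s ∈ Rg[c], s ≠ 0 → -1 / 2 ≤ s.re → ‖Φ s‖ ≤ M * Real.log (|s.im| + 4) / ‖s‖ ^ 2)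
    {κ : ℝ} (hκ0 : 0 < κ) (hκ : κ ≤ 1 / 2) {T : ℝ} (hT : 1 ≤ T)
    (hint : Integrable fun t : ℝ ↦ Θ (κ + t * I)) :
    ‖∫ t : ℝ, Θ (κ + t * I)‖ ≤
      M * (20 * x ^ κ * T ^ (-(1 / 2 : ℝ)) + 2 * x ^ κ * Real.log (T + 4) / T ^ 2 +
        2 * π / c * Real.log (T + 4) ^ 2 * x ^ (-(c / (2 * Real.log (T + 4))))) := by
  have hx0 : 0 < x := by linarith
  have hT0 : 0 < T := by linarith
  set ℓ : ℝ := Real.log (T + 4) with hℓ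
  have hℓ5 : Real.log 5 ≤ ℓ := Real.log_le_log (by norm_num) (by linarith)
  have hlog5 : 1 < Real.log 5 := by
    rw [Real.lt_log_iff_exp_lt (by norm_num)]
    linarith [Real.exp_one_lt_d9]
  have hℓ1 : 1 < ℓ := hlog5.trans_le hℓ5
  have hℓ0 : 0 < ℓ := by linarith
  set σ₁ : ℝ := c / (2 * ℓ) with hσ₁def
  have hσ₁0 : 0 < σ₁ := by positivity
  have hσ₁h : σ₁ ≤ 1 / 2 := by
    rw [hσ₁def, div_le_iff₀ (by positivity)]; linarith
  have hσ₁κ : -σ₁ ≤ κ := by linarith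
  have hκ1 : κ < 1 := by linarith
  -- `Θ` is holomorphic on the region
  have hΘd : DifferentiableOn ℂ Θ Rg[c] := by
    have : Θ = fun s ↦ (x : ℂ) ^ s * Φ s := funext hΘ
    rw [this]
    refine DifferentiableOn.mul (fun s _ ↦ ?_) hΦd
    exact (differentiableAt_id.const_cpow (Or.inl (ofReal_ne_zero.2 hx0.ne'))).differentiableWithinAt
  have hsplit := integral_line_eq hc hΘd hT0 hκ1 hσ₁κ le_rfl hint
  have b1 := norm_integral_Iic_le hc hM hx hΘ hΦb hκ0 hκ hT
  have b2 := norm_integral_Ioi_le hc hM hx hΘ hΦb hκ0 hκ hT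
  have b3 := norm_integral_left_le hc hM hx hΘ hΦb hT hσ₁0 hσ₁h le_rfl
  have b4 := norm_integral_horizontal_le hc hM hx hΘ hΦb hκ1 hT hσ₁κ hσ₁h le_rfl (T' := -T)
    (by rw [abs_neg, abs_of_pos hT0])
  have b5 := norm_integral_horizontal_le hc hM hx hΘ hΦb hκ1 hT hσ₁κ hσ₁h le_rfl (T' := T)
    (abs_of_pos hT0)
  simp only [ofReal_neg, neg_mul] at b3 b4 hsplit
  have hI : ∀ z : ℂ, ‖I * z‖ = ‖z‖ := fun z ↦ by rw [norm_mul, norm_I, one_mul]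
  rw [hsplit]
  refine (ClassicalPsiData.norm_add_add_add_sub_le _ _ _ _ _).trans ?_
  rw [hI, hI]
  have hκσ : κ + σ₁ ≤ 1 := by linarith
  have s45 : M * Real.log (T + 4) * x ^ κ / T ^ 2 * (κ + σ₁) ≤ M * ℓ * x ^ κ / T ^ 2 := by
    rw [← hℓ]
    have h0 : 0 ≤ M * ℓ * x ^ κ / T ^ 2 := by positivity
    calc M * ℓ * x ^ κ / T ^ 2 * (κ + σ₁) ≤ M * ℓ * x ^ κ / T ^ 2 * 1 := by gcongr
      _ = _ := mul_one _
  have s3 : M * Real.log (T + 4) * x ^ (-σ₁) * (π / σ₁) = M * (2 * π / c * ℓ ^ 2 * x ^ (-σ₁)) := by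
    rw [← hℓ, hσ₁def]; field_simp
  have := add_le_add (add_le_add (add_le_add (add_le_add b1 b2) b3) (b4.trans s45)) (b5.trans s45)
  refine this.trans (le_of_eq ?_)
  rw [s3, hσ₁def]
  ring

end Pieces

end PerronShift


/-! ## The number-field case: logarithmic Riesz means of the coefficients of `H(s)/ζ_K(s)` -/

namespace NumberField

open LSeries

variable (K : Type*) [Field K] [NumberField K]

/-- Local notation for the entire function `ζ_K,₁(s) = (s − 1)ζ_K(s)` (`ρ_K` at `s = 1`) of
`DedekindZetaClassicalRegionBounds.lean`. -/
local notation3 "ζ₁[" K "]" =>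
  Function.update (fun s : ℂ ↦ (s - 1) * dedekindZetaCont K s) 1
    ((_root_.NumberField.dedekindZeta_residue K : ℝ) : ℂ)

/-- Local notation for the translated classical region `−c/log(|t|+4) < σ < 1`. -/
local notation3 "Rg[" c "]" => {s : ℂ | -c / Real.log (|s.im| + 4) < s.re ∧ s.re < 1}

/-- `‖L(f, s)‖ ≤ ∑ ‖f(n) n^{-σ₀}‖` for `σ₀ ≤ Re s` when the right side converges. [folklore] -/
theorem norm_LSeries_le_tsum {f : ℕ → ℂ} {σ₀ : ℝ} (hf : LSeriesSummable f σ₀) {s : ℂ}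
    (hs : σ₀ ≤ s.re) : ‖LSeries f s‖ ≤ ∑' n, ‖term f σ₀ n‖ := by
  have hs'' : (σ₀ : ℂ).re ≤ s.re := by simpa using hs
  have hs' : LSeriesSummable f s := hf.of_re_le_re hs''
  calc ‖LSeries f s‖ ≤ ∑' n, ‖term f s n‖ := norm_tsum_le_tsum_norm hs'.norm
    _ ≤ ∑' n, ‖term f σ₀ n‖ :=
      Summable.tsum_le_tsum (fun n ↦ norm_term_le_of_re_le_re f hs'' n) hs'.norm hf.norm

variable {K} in
/-- `ζ_K,₁(w) = (w − 1)·ζ_K(w)` with Mathlib's Dirichlet series `NumberField.dedekindZeta K` for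
`Re w > 1` (`dedekindZeta₁_eq` and `isDedekindZetaContinuation_dedekindZetaCont_holds`). [folklore] -/
theorem dedekindZeta₁_eq_mul_dedekindZeta {w : ℂ} (hw : 1 < w.re) :
    ζ₁[K] w = (w - 1) * _root_.NumberField.dedekindZeta K w := by
  have hw1 : w ≠ 1 := by rintro rfl; simp at hw
  rw [dedekindZeta₁_eq (K := K) hw1, (isDedekindZetaContinuation_dedekindZetaCont_holds K).eqOn hw]

/-- The terms of `∑ (a(n)/n) n^{-s}` are those of `∑ a(n) n^{-(1+s)}`. [folklore] -/
theorem term_div_natCast_eq (a : ℕ → ℂ) (s : ℂ) (n : ℕ) :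
    term (fun n ↦ a n / n) s n = term a (1 + s) n := by
  rcases eq_or_ne n 0 with rfl | hn
  · simp [term_zero]
  · simp only [term_of_ne_zero hn]
    rw [cpow_add _ _ (Nat.cast_ne_zero.2 hn), cpow_one, div_div]

/-- **The logarithmic Riesz mean as a shifted Perron integral plus the residue term**: if
`∑ a(n) n^{-(1+κ)}` converges absolutely (`κ > 0`), `L(a, 1+s) = Ψ(s)·s` on `Re s = κ` and
`Φ(s) = Ψ(s)/s − Ψ(0)/(s(s+1))` there, then for `x > 0`
`∑_{n ≤ x} (a(n)/n) log(x/n) = (1/2π) ∫ x^{κ+it} Φ(κ+it) dt + Ψ(0)·(1 − 1/x)⁺`, the integral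
converging absolutely (Perron's formula for logarithmic means, `LogRieszMean.sum_mul_log_eq_integral_LSeries`,
and the order-one kernel `RieszMean.integral_cpow_mul_kernel`). [cite: MontgomeryVaughan2007, §5.1 (5.19) to (5.22)] -/
theorem logRieszMean_eq_integral_add {a : ℕ → ℂ} {Ψ Φ : ℂ → ℂ} {x κ : ℝ} (hx : 0 < x)
    (hκ : 0 < κ) (ha : LSeriesSummable a ((1 : ℂ) + κ))
    (hΨline : ∀ t : ℝ, LSeries a (1 + ((κ : ℂ) + t * I)) = Ψ ((κ : ℂ) + t * I) * ((κ : ℂ) + t * I))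
    (hΦeq : ∀ t : ℝ, Φ ((κ : ℂ) + t * I) = Ψ ((κ : ℂ) + t * I) / ((κ : ℂ) + t * I) -
      Ψ 0 / (((κ : ℂ) + t * I) * (((κ : ℂ) + t * I) + 1))) :
    (∑ n ∈ Finset.Ioc 0 ⌊x⌋₊, a n / n * (Real.log (x / n) : ℂ)) =
        (1 / (2 * π) : ℂ) * (∫ t : ℝ, (x : ℂ) ^ ((κ : ℂ) + t * I) * Φ (κ + t * I)) +
          Ψ 0 * ((max (1 - x⁻¹) 0 : ℝ) : ℂ) ∧
      Integrable (fun t : ℝ ↦ (x : ℂ) ^ ((κ : ℂ) + t * I) * Φ (κ + t * I)) := by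
  set b : ℕ → ℂ := fun n ↦ a n / n with hb
  have hterm : term b κ = term a ((1 : ℂ) + κ) := funext fun n ↦ term_div_natCast_eq a κ n
  have hbs : LSeriesSummable b κ := by
    unfold LSeriesSummable; rw [hterm]; exact ha
  have hLb : ∀ s : ℂ, LSeries b s = LSeries a (1 + s) := by
    intro s
    simp only [LSeries]
    exact tsum_congr fun n ↦ term_div_natCast_eq a s n
  have hP := LogRieszMean.sum_mul_log_eq_integral_LSeries b hx hκ hbs
  have hPint := LogRieszMean.integrable_cpow_mul_LSeries_mul_invSq b hx hκ hbs
  have hKint := RieszMean.integrable_cpow_mul_kernel hκ hx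
  have hKval := RieszMean.integral_cpow_mul_kernel hκ hx
  have hs0 : ∀ t : ℝ, (κ : ℂ) + t * I ≠ 0 := LogRieszMean.line_ne_zero hκ
  have hs1 : ∀ t : ℝ, (κ : ℂ) + t * I + 1 ≠ 0 := fun t h ↦ by
    have := congrArg Complex.re h; simp at this; linarith
  have hpt : ∀ t : ℝ, (x : ℂ) ^ ((κ : ℂ) + t * I) * LSeries b (κ + t * I) *
      (1 / ((κ : ℂ) + t * I) ^ 2) =
      (x : ℂ) ^ ((κ : ℂ) + t * I) * Φ (κ + t * I) +
        Ψ 0 * ((x : ℂ) ^ ((κ : ℂ) + t * I) *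
          (1 / (((κ : ℂ) + t * I) * ((κ : ℂ) + t * I + 1)))) := by
    intro t
    rw [hLb, hΨline t, hΦeq t]
    field_simp [hs0 t, hs1 t]
    ring
  have hΦint : Integrable (fun t : ℝ ↦ (x : ℂ) ^ ((κ : ℂ) + t * I) * Φ (κ + t * I)) := by
    refine ((hPint.sub (hKint.const_mul (Ψ 0))).congr (Eventually.of_forall fun t ↦ ?_))
    simp only [Pi.sub_apply]
    rw [hpt t]
    ring
  refine ⟨?_, hΦint⟩
  rw [hP, integral_congr_ae (Eventually.of_forall hpt), integral_add hΦint (hKint.const_mul _),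
    MeasureTheory.integral_const_mul, ← hKval]
  ring

/-- **The package `Ψ, Φ` attached to `H/ζ_K`.** Let `G = ζ_K,₁` satisfy the three bounds of
`dedekindZeta₁_classicalRegion_bounds` with constants `c₀, C₀`, let `∑ |h(n)| n^{-σ_h} ≤ B`, and
`0 < c ≤ min(c₀, 1 − σ_h, 1/2)`. Put `Ψ(s) = L(h, 1+s)/G(1+s)` and `Φ(s) = dslope Ψ 0 s + Ψ(0)/(s+1)`.
Then on the region `−c/log(|t|+4) < σ < 1`: `Φ` is holomorphic, `Φ(s) = Ψ(s)/s − Ψ(0)/(s(s+1))`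
off `0`, and `‖Φ(s)‖ ≤ B(C₀ + 1/ρ_K) log(|t|+4)/|s|²` for `σ ≥ −1/2`, `s ≠ 0`; moreover
`Ψ(0) = L(h,1)/ρ_K` and `‖Ψ(0)‖ ≤ B/ρ_K`. [folklore] -/
theorem logRieszMean_psi_phi_package {c₀ C₀ c σₕ B : ℝ} {h : ℕ → ℂ} (hC₀ : 0 < C₀)
    (hG : ∀ s : ℂ, 1 - c₀ / Real.log (|s.im| + 4) ≤ s.re → s.re ≤ 2 →
      ζ₁[K] s ≠ 0 ∧ ‖(s - 1) / ζ₁[K] s‖ ≤ C₀ * Real.log (|s.im| + 4) ∧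
        ‖deriv ζ₁[K] s / ζ₁[K] s‖ ≤ C₀ * Real.log (|s.im| + 4))
    (hh : LSeriesSummable h σₕ) (hhB : ∑' n, ‖term h σₕ n‖ ≤ B)
    (hc : 0 < c) (hcc₀ : c ≤ c₀) (hcδ : c ≤ 1 - σₕ) (hc2 : c ≤ 1 / 2) :
    let Ψ : ℂ → ℂ := fun s ↦ LSeries h (1 + s) / ζ₁[K] (1 + s)
    let Φ : ℂ → ℂ := fun s ↦ dslope Ψ 0 s + Ψ 0 / (s + 1)
    DifferentiableOn ℂ Φ Rg[c] ∧
    (∀ s : ℂ, s ≠ 0 → s + 1 ≠ 0 → Φ s = Ψ s / s - Ψ 0 / (s * (s + 1))) ∧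
    (∀ s ∈ Rg[c], s ≠ 0 → -1 / 2 ≤ s.re →
      ‖Φ s‖ ≤ B * (C₀ + 1 / _root_.NumberField.dedekindZeta_residue K) *
        Real.log (|s.im| + 4) / ‖s‖ ^ 2) ∧
    Ψ 0 = LSeries h 1 / (_root_.NumberField.dedekindZeta_residue K : ℂ) ∧
    ‖Ψ 0‖ ≤ B / _root_.NumberField.dedekindZeta_residue K ∧
    (∀ s ∈ Rg[c], ζ₁[K] (1 + s) ≠ 0) := by
  intro Ψ Φ
  set ρ : ℝ := _root_.NumberField.dedekindZeta_residue K with hρdef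
  have hρ : 0 < ρ := _root_.NumberField.dedekindZeta_residue_pos K
  set G : ℂ → ℂ := ζ₁[K] with hGdef
  have hB : 0 ≤ B := le_trans (tsum_nonneg fun n ↦ norm_nonneg _) hhB
  have hG1 : G 1 = (ρ : ℂ) := by simp [hGdef, hρdef]
  have hΨ0 : Ψ 0 = LSeries h 1 / ρ := by
    show LSeries h (1 + 0) / G (1 + 0) = _
    rw [add_zero, hG1]
  -- `H = L(h, ·)`: bound and holomorphy
  have hHb : ∀ w : ℂ, σₕ ≤ w.re → ‖LSeries h w‖ ≤ B := fun w hw ↦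
    (norm_LSeries_le_tsum hh hw).trans hhB
  have hHd : DifferentiableOn ℂ (LSeries h) {w : ℂ | σₕ < w.re} := by
    refine (LSeries_differentiableOn h).mono fun w (hw : σₕ < w.re) ↦ ?_
    have h1 : abscissaOfAbsConv h ≤ ((σₕ : ℂ).re : EReal) := hh.abscissaOfAbsConv_le
    simp only [ofReal_re] at h1
    exact h1.trans_lt (by exact_mod_cast hw)
  -- points of the region
  have hlog4 : ∀ t : ℝ, 1 < Real.log (|t| + 4) := fun t ↦
    ClassicalZFRData.one_lt_log_four.trans_le
      (Real.log_le_log (by norm_num) (by linarith [abs_nonneg t]))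
  have hreg : ∀ s ∈ Rg[c], -c < s.re ∧ s.re < 1 := by
    rintro s ⟨h1, h2⟩
    refine ⟨lt_of_le_of_lt ?_ h1, h2⟩
    rw [neg_div, neg_le_neg_iff, div_le_iff₀ (by linarith [hlog4 s.im])]
    nlinarith [hlog4 s.im]
  have hGreg : ∀ s ∈ Rg[c], G (1 + s) ≠ 0 ∧ ‖s / G (1 + s)‖ ≤ C₀ * Real.log (|s.im| + 4) := by
    rintro s ⟨h1, h2⟩
    have him : (1 + s).im = s.im := by simp
    have hre : (1 + s).re = 1 + s.re := by simp
    have hc' : c / Real.log (|s.im| + 4) ≤ c₀ / Real.log (|s.im| + 4) :=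
      div_le_div_of_nonneg_right hcc₀ (by linarith [hlog4 s.im])
    obtain ⟨hne, hb, -⟩ := hG (1 + s) (by rw [him, hre]; rw [neg_div] at h1; linarith)
      (by rw [hre]; linarith)
    refine ⟨hne, ?_⟩
    rwa [him, show 1 + s - 1 = s by ring] at hb
  -- `Ψ`: holomorphy and bound
  have hΨd : DifferentiableOn ℂ Ψ Rg[c] := by
    refine DifferentiableOn.div ?_ ?_ fun s hs ↦ (hGreg s hs).1
    · refine (hHd.comp ((differentiableOn_const _).add differentiableOn_id) fun s hs ↦ ?_)
      show σₕ < (1 + s).re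
      have := (hreg s hs).1
      simp only [add_re, one_re]; linarith
    · exact ((differentiable_dedekindZeta₁ K).comp
        ((differentiable_const _).add differentiable_id)).differentiableOn
  have hΨb : ∀ s ∈ Rg[c], s ≠ 0 → ‖Ψ s‖ ≤ B * C₀ * Real.log (|s.im| + 4) / ‖s‖ := by
    intro s hs hs0
    obtain ⟨hne, hb⟩ := hGreg s hs
    have hsn : 0 < ‖s‖ := norm_pos_iff.2 hs0
    have hH : ‖LSeries h (1 + s)‖ ≤ B :=
      hHb _ (by have := (hreg s hs).1; simp only [add_re, one_re]; linarith)
    have hinv : ‖(G (1 + s))⁻¹‖ ≤ C₀ * Real.log (|s.im| + 4) / ‖s‖ := by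
      rw [le_div_iff₀ hsn, ← norm_mul, inv_mul_eq_div]
      exact hb
    calc ‖Ψ s‖ = ‖LSeries h (1 + s)‖ * ‖(G (1 + s))⁻¹‖ := by
          rw [← norm_mul, ← div_eq_mul_inv]
      _ ≤ B * (C₀ * Real.log (|s.im| + 4) / ‖s‖) := by gcongr
      _ = B * C₀ * Real.log (|s.im| + 4) / ‖s‖ := by ring
  have hΨ0b : ‖Ψ 0‖ ≤ B / ρ := by
    rw [hΨ0, norm_div, Complex.norm_real, Real.norm_of_nonneg hρ.le]
    exact div_le_div_of_nonneg_right (hHb 1 (by simp; linarith)) hρ.le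
  -- `Φ`: holomorphy, the formula off `0`, and the bound
  have hzero : (0 : ℂ) ∈ Rg[c] := PerronShift.zero_mem_region hc
  have hs1 : ∀ s ∈ Rg[c], s + 1 ≠ 0 := fun s hs h0 ↦ by
    have := congrArg Complex.re h0
    have h' := (hreg s hs).1
    simp at this; linarith
  have hΦd : DifferentiableOn ℂ Φ Rg[c] := by
    refine DifferentiableOn.add ?_ ?_
    · exact (Complex.differentiableOn_dslope
        ((PerronShift.isOpen_region c).mem_nhds hzero)).2 hΨd
    · exact (differentiableOn_const _).div (differentiableOn_id.add (differentiableOn_const _)) hs1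
  have hΦeq : ∀ s : ℂ, s ≠ 0 → s + 1 ≠ 0 → Φ s = Ψ s / s - Ψ 0 / (s * (s + 1)) := by
    intro s hs0 hs1
    show dslope Ψ 0 s + Ψ 0 / (s + 1) = _
    rw [dslope_of_ne _ hs0, slope_def_field, sub_zero]
    field_simp
    ring
  have hΦb : ∀ s ∈ Rg[c], s ≠ 0 → -1 / 2 ≤ s.re →
      ‖Φ s‖ ≤ B * (C₀ + 1 / ρ) * Real.log (|s.im| + 4) / ‖s‖ ^ 2 := by
    intro s hs hs0 hsre
    have hsn : 0 < ‖s‖ := norm_pos_iff.2 hs0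
    have hs1' := hs1 s hs
    have hsn1 : 0 < ‖s + 1‖ := norm_pos_iff.2 hs1'
    have hn1 : ‖s‖ ≤ ‖s + 1‖ := by
      have h1 : ‖s‖ ^ 2 ≤ ‖s + 1‖ ^ 2 := by
        rw [Complex.sq_norm, Complex.sq_norm, Complex.normSq_apply, Complex.normSq_apply]
        simp only [add_re, one_re, add_im, one_im, add_zero]
        nlinarith
      exact (pow_le_pow_iff_left₀ (norm_nonneg _) (norm_nonneg _) two_ne_zero).1 h1
    have hlog1 : 1 ≤ Real.log (|s.im| + 4) := (hlog4 s.im).le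
    have hΨs := hΨb s hs hs0
    have hΨ0n : ‖Ψ 0‖ ≤ B / ρ * Real.log (|s.im| + 4) :=
      hΨ0b.trans (le_mul_of_one_le_right (by positivity) hlog1)
    rw [hΦeq s hs0 hs1']
    calc ‖Ψ s / s - Ψ 0 / (s * (s + 1))‖ ≤ ‖Ψ s / s‖ + ‖Ψ 0 / (s * (s + 1))‖ := norm_sub_le _ _
      _ = ‖Ψ s‖ / ‖s‖ + ‖Ψ 0‖ / (‖s‖ * ‖s + 1‖) := by simp only [norm_div, norm_mul]
      _ ≤ (B * C₀ * Real.log (|s.im| + 4) / ‖s‖) / ‖s‖ +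
            (B / ρ * Real.log (|s.im| + 4)) / (‖s‖ * ‖s‖) := by
          gcongr
      _ = B * (C₀ + 1 / ρ) * Real.log (|s.im| + 4) / ‖s‖ ^ 2 := by
          field_simp
  exact ⟨hΦd, hΦeq, hΦb, hΨ0, hΨ0b, fun s hs ↦ (hGreg s hs).1⟩

/-- `u² e^{−a u} ≤ 4/a²` for `a > 0`, `u ≥ 0` (from `(a/2)u ≤ e^{(a/2)u}`). [folklore] -/
theorem sq_mul_exp_neg_le {a u : ℝ} (ha : 0 < a) (hu : 0 ≤ u) :
    u ^ 2 * Real.exp (-(a * u)) ≤ 4 / a ^ 2 := by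
  have h1 : a / 2 * u ≤ Real.exp (a / 2 * u) := by linarith [Real.add_one_le_exp (a / 2 * u)]
  have h2 : u ≤ 2 / a * Real.exp (a / 2 * u) := by
    rw [div_mul_eq_mul_div, le_div_iff₀ ha]; linarith
  have h3 : u ^ 2 ≤ (2 / a * Real.exp (a / 2 * u)) ^ 2 := pow_le_pow_left₀ hu h2 2
  have h4 : (2 / a * Real.exp (a / 2 * u)) ^ 2 = 4 / a ^ 2 * Real.exp (a * u) := by
    rw [mul_pow, ← Real.exp_nat_mul]; congr 1; · ring
    congr 1; push_cast; ring
  rw [h4] at h3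
  calc u ^ 2 * Real.exp (-(a * u)) ≤ 4 / a ^ 2 * Real.exp (a * u) * Real.exp (-(a * u)) := by
        gcongr
    _ = 4 / a ^ 2 := by rw [mul_assoc, ← Real.exp_add, add_neg_cancel, Real.exp_zero, mul_one]

/-- `u e^{−2u} ≤ e^{−u}`. [folklore] -/
theorem mul_exp_neg_two_mul_le (u : ℝ) : u * Real.exp (-(2 * u)) ≤ Real.exp (-u) := by
  have h1 : u ≤ Real.exp u := by linarith [Real.add_one_le_exp u]
  have h2 : Real.exp u * Real.exp (-(2 * u)) = Real.exp (-u) := by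
    rw [← Real.exp_add]; ring_nf
  calc u * Real.exp (-(2 * u)) ≤ Real.exp u * Real.exp (-(2 * u)) := by gcongr
    _ = Real.exp (-u) := h2

/-- `5 ≤ e²`. [folklore] -/
theorem five_le_exp_two_real : (5 : ℝ) ≤ Real.exp 2 := by
  have h1 := Real.exp_one_gt_d9
  have h' : Real.exp 2 = Real.exp 1 * Real.exp 1 := by rw [← Real.exp_add]; norm_num
  rw [h']
  calc (5 : ℝ) ≤ 2.7182818283 * 2.7182818283 := by norm_num
    _ ≤ Real.exp 1 * Real.exp 1 := mul_le_mul h1.le h1.le (by norm_num) (Real.exp_pos 1).le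

/-- **The endgame for large `x`** (`x ≥ e⁴`, `κ = 1/log x`, `T = exp(√log x)`): the shifted-contour
bound plus the term `B/(ρx)` is `≤ ((C₀ + 1/ρ)A + 2/ρ)·B·exp(−(c/8)√log x)`,
`A = 48e² + 16π/c + 2048π/c³ + 24e`. [cite: MontgomeryVaughan2007, §6.2 (proof of Theorem 6.9)] -/
theorem logRieszMean_endgame_large {c C₀ ρ B x : ℝ} (hc : 0 < c) (hc2 : c ≤ 1 / 2) (hC₀ : 0 < C₀) (hρ : 0 < ρ)
    (hB : 0 ≤ B) (hxe : Real.exp 4 ≤ x) :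
    B * (C₀ + 1 / ρ) *
        (20 * x ^ (1 / Real.log x) * Real.exp (Real.sqrt (Real.log x)) ^ (-(1 / 2 : ℝ)) +
          2 * x ^ (1 / Real.log x) * Real.log (Real.exp (Real.sqrt (Real.log x)) + 4) /
            Real.exp (Real.sqrt (Real.log x)) ^ 2 +
          2 * π / c * Real.log (Real.exp (Real.sqrt (Real.log x)) + 4) ^ 2 *
            x ^ (-(c / (2 * Real.log (Real.exp (Real.sqrt (Real.log x)) + 4))))) +
      B / ρ * x⁻¹ ≤
      ((C₀ + 1 / ρ) * (48 * Real.exp 2 + 16 * π / c + 2048 * π / c ^ 3 + 24 * Real.exp 1) + 2 / ρ) *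
        B * Real.exp (-(c / 8) * Real.sqrt (Real.log x)) := by
  have hx0 : 0 < x := (Real.exp_pos 4).trans_le hxe
  have hx : 1 ≤ x := le_trans (by have := Real.add_one_le_exp (4:ℝ); linarith) hxe
  set L : ℝ := Real.log x with hL
  have hL4 : 4 ≤ L := by
    rw [hL, ← Real.log_exp 4]; exact Real.log_le_log (Real.exp_pos 4) hxe
  have hLpos : 0 < L := by linarith
  set lam : ℝ := Real.sqrt L with hlam
  have hlam2 : 2 ≤ lam := by
    rw [hlam, Real.le_sqrt' (by norm_num : (0 : ℝ) < 2)]; linarith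
  have hlam0 : 0 ≤ lam := by linarith
  have hlampos : 0 < lam := by linarith
  have hlamsq : lam ^ 2 = L := Real.sq_sqrt hLpos.le
  set T : ℝ := Real.exp lam with hT
  have hT1 : 1 ≤ T := Real.one_le_exp hlam0
  have hT0 : 0 < T := by linarith
  have hlogT : Real.log T = lam := Real.log_exp lam
  set ℓ : ℝ := Real.log (T + 4) with hℓ
  have hℓlam : lam ≤ ℓ := by rw [← hlogT, hℓ]; exact Real.log_le_log hT0 (by linarith)
  have hℓ0 : 0 < ℓ := by linarith
  have hℓ2 : ℓ ≤ 2 * lam := by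
    have h5 : Real.log (T + 4) ≤ Real.log (Real.exp 2 * T) := by
      refine Real.log_le_log (by linarith) ?_
      have := mul_le_mul_of_nonneg_right five_le_exp_two_real hT0.le
      linarith
    rw [Real.log_mul (Real.exp_pos 2).ne' hT0.ne', Real.log_exp, hlogT] at h5
    linarith
  -- the pieces
  have hxκ : x ^ (1 / L) = Real.exp 1 := by
    rw [Real.rpow_def_of_pos hx0, ← hL, mul_one_div_cancel hLpos.ne']
  have hTpow : T ^ (-(1 / 2 : ℝ)) = Real.exp (-(lam / 2)) := by
    rw [hT, ← Real.exp_mul]; congr 1; ring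
  have hT2 : 1 / T ^ 2 = Real.exp (-(2 * lam)) := by
    rw [hT, sq, ← Real.exp_add, Real.exp_neg, one_div]; congr 1; ring_nf
  have hxpow : x ^ (-(c / (2 * ℓ))) ≤ Real.exp (-(c / 4 * lam)) := by
    rw [Real.rpow_def_of_pos hx0, ← hL]
    apply Real.exp_le_exp.2
    have key : c / 4 * lam ≤ L * (c / (2 * ℓ)) := by
      rw [mul_div_assoc', le_div_iff₀ (by positivity), ← hlamsq]
      have := mul_le_mul_of_nonneg_left hℓ2 (mul_pos hc hlampos).le
      nlinarith
    linarith
  -- exponential comparisons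
  have e1 : Real.exp (-(lam / 2)) ≤ Real.exp (-(c / 8 * lam)) :=
    Real.exp_le_exp.2 (by nlinarith)
  have e2 : lam * Real.exp (-(2 * lam)) ≤ Real.exp (-(c / 8 * lam)) :=
    (mul_exp_neg_two_mul_le lam).trans (Real.exp_le_exp.2 (by nlinarith))
  have e3 : lam ^ 2 * Real.exp (-(c / 4 * lam)) ≤ 256 / c ^ 2 * Real.exp (-(c / 8 * lam)) := by
    have h1 := sq_mul_exp_neg_le (a := c / 8) (u := lam) (by positivity) hlam0
    have h2 : Real.exp (-(c / 4 * lam)) =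
        Real.exp (-(c / 8 * lam)) * Real.exp (-(c / 8 * lam)) := by
      rw [← Real.exp_add]; ring_nf
    rw [h2, ← mul_assoc]
    calc lam ^ 2 * Real.exp (-(c / 8 * lam)) * Real.exp (-(c / 8 * lam))
        ≤ 4 / (c / 8) ^ 2 * Real.exp (-(c / 8 * lam)) := by gcongr
      _ = 256 / c ^ 2 * Real.exp (-(c / 8 * lam)) := by ring
  have e4 : x⁻¹ ≤ Real.exp (-(c / 8 * lam)) := by
    have hxL : x⁻¹ = Real.exp (-L) := by rw [hL, Real.exp_neg, Real.exp_log hx0]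
    rw [hxL, Real.exp_le_exp, neg_le_neg_iff, ← hlamsq]
    nlinarith
  -- sizes of the pieces
  set E : ℝ := Real.exp (-(c / 8 * lam)) with hE
  have hE0 : 0 < E := Real.exp_pos _
  have s1 : 20 * x ^ (1 / L) * T ^ (-(1 / 2 : ℝ)) ≤ 20 * Real.exp 1 * E := by
    rw [hxκ, hTpow]; gcongr
  have s2 : 2 * x ^ (1 / L) * Real.log (T + 4) / T ^ 2 ≤ 4 * Real.exp 1 * E := by
    rw [hxκ, ← hℓ, div_eq_mul_one_div, hT2]
    calc 2 * Real.exp 1 * ℓ * Real.exp (-(2 * lam))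
        ≤ 2 * Real.exp 1 * (2 * lam) * Real.exp (-(2 * lam)) := by gcongr
      _ = 4 * Real.exp 1 * (lam * Real.exp (-(2 * lam))) := by ring
      _ ≤ 4 * Real.exp 1 * E := by gcongr
  have s3 : 2 * π / c * Real.log (T + 4) ^ 2 * x ^ (-(c / (2 * Real.log (T + 4)))) ≤
      2048 * π / c ^ 3 * E := by
    rw [← hℓ]
    calc 2 * π / c * ℓ ^ 2 * x ^ (-(c / (2 * ℓ)))
        ≤ 2 * π / c * (2 * lam) ^ 2 * Real.exp (-(c / 4 * lam)) := by gcongr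
      _ = 8 * π / c * (lam ^ 2 * Real.exp (-(c / 4 * lam))) := by ring
      _ ≤ 8 * π / c * (256 / c ^ 2 * E) := by gcongr
      _ = 2048 * π / c ^ 3 * E := by field_simp; ring
  have s4 : B / ρ * x⁻¹ ≤ B / ρ * E := by gcongr
  have hK0 : 0 ≤ B * (C₀ + 1 / ρ) := by positivity
  have h1 := add_le_add (mul_le_mul_of_nonneg_left (add_le_add (add_le_add s1 s2) s3) hK0) s4
  refine h1.trans ?_
  have hfin : B * (C₀ + 1 / ρ) * (20 * Real.exp 1 * E + 4 * Real.exp 1 * E + 2048 * π / c ^ 3 * E) +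
      B / ρ * E =
      ((C₀ + 1 / ρ) * (24 * Real.exp 1 + 2048 * π / c ^ 3) + 1 / ρ) * B * E := by ring
  rw [hfin, show -(c / 8) * Real.sqrt (Real.log x) = -(c / 8 * lam) by rw [← hL, ← hlam]; ring,
    ← hE]
  have hmono : (C₀ + 1 / ρ) * (24 * Real.exp 1 + 2048 * π / c ^ 3) + 1 / ρ ≤
      (C₀ + 1 / ρ) * (48 * Real.exp 2 + 16 * π / c + 2048 * π / c ^ 3 + 24 * Real.exp 1) + 2 / ρ := by
    have h2 : 24 * Real.exp 1 + 2048 * π / c ^ 3 ≤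
        48 * Real.exp 2 + 16 * π / c + 2048 * π / c ^ 3 + 24 * Real.exp 1 := by
      have : 0 ≤ 48 * Real.exp 2 + 16 * π / c := by positivity
      linarith
    have h3 : 1 / ρ ≤ 2 / ρ := div_le_div_of_nonneg_right (by norm_num) hρ.le
    gcongr
  exact mul_le_mul_of_nonneg_right (mul_le_mul_of_nonneg_right hmono hB) hE0.le

/-- **The endgame for small `x`** (`1 ≤ x < e⁴`, `κ = 1/2`, `T = 1`). [folklore] -/
theorem logRieszMean_endgame_small {c C₀ ρ B x : ℝ} (hc : 0 < c) (hc2 : c ≤ 1 / 2) (hC₀ : 0 < C₀) (hρ : 0 < ρ)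
    (hB : 0 ≤ B) (hx : 1 ≤ x) (hxe : x < Real.exp 4) :
    B * (C₀ + 1 / ρ) *
        (20 * x ^ (1 / 2 : ℝ) * (1 : ℝ) ^ (-(1 / 2 : ℝ)) +
          2 * x ^ (1 / 2 : ℝ) * Real.log (1 + 4) / (1 : ℝ) ^ 2 +
          2 * π / c * Real.log (1 + 4) ^ 2 * x ^ (-(c / (2 * Real.log (1 + 4))))) +
      B / ρ * x⁻¹ ≤
      ((C₀ + 1 / ρ) * (48 * Real.exp 2 + 16 * π / c + 2048 * π / c ^ 3 + 24 * Real.exp 1) + 2 / ρ) *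
        B * Real.exp (-(c / 8) * Real.sqrt (Real.log x)) := by
  have hx0 : 0 < x := by linarith
  set L : ℝ := Real.log x with hL
  have hL0 : 0 ≤ L := Real.log_nonneg hx
  have hL4 : L < 4 := by
    rw [hL, ← Real.log_exp 4]; exact Real.log_lt_log hx0 hxe
  set lam : ℝ := Real.sqrt L with hlam
  have hlam0 : 0 ≤ lam := Real.sqrt_nonneg _
  have hlam2 : lam < 2 := by
    rw [hlam, Real.sqrt_lt' (by norm_num : (0 : ℝ) < 2)]; linarith
  have hx12 : x ^ (1 / 2 : ℝ) ≤ Real.exp 2 := by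
    calc x ^ (1 / 2 : ℝ) ≤ (Real.exp 4) ^ (1 / 2 : ℝ) :=
          Real.rpow_le_rpow hx0.le hxe.le (by norm_num)
      _ = Real.exp 2 := by rw [← Real.exp_mul]; norm_num
  have hlog5 : Real.log ((1 : ℝ) + 4) ≤ 2 := by
    rw [show (1 : ℝ) + 4 = 5 by norm_num, Real.log_le_iff_le_exp (by norm_num)]
    exact five_le_exp_two_real
  have hlog50 : 0 ≤ Real.log ((1 : ℝ) + 4) := Real.log_nonneg (by norm_num)
  have hxneg : x ^ (-(c / (2 * Real.log ((1 : ℝ) + 4)))) ≤ 1 :=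
    Real.rpow_le_one_of_one_le_of_nonpos hx (by
      have : 0 ≤ c / (2 * Real.log ((1 : ℝ) + 4)) := by positivity
      linarith)
  have hone : (1 : ℝ) ^ (-(1 / 2 : ℝ)) = 1 := Real.one_rpow _
  have hbr : 20 * x ^ (1 / 2 : ℝ) * (1 : ℝ) ^ (-(1 / 2 : ℝ)) +
      2 * x ^ (1 / 2 : ℝ) * Real.log (1 + 4) / (1 : ℝ) ^ 2 +
      2 * π / c * Real.log (1 + 4) ^ 2 * x ^ (-(c / (2 * Real.log (1 + 4)))) ≤
      24 * Real.exp 2 + 8 * π / c := by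
    rw [hone, one_pow, div_one, mul_one]
    have h1 : 20 * x ^ (1 / 2 : ℝ) ≤ 20 * Real.exp 2 := by gcongr
    have h2 : 2 * x ^ (1 / 2 : ℝ) * Real.log (1 + 4) ≤ 2 * Real.exp 2 * 2 := by gcongr
    have h3 : 2 * π / c * Real.log (1 + 4) ^ 2 * x ^ (-(c / (2 * Real.log (1 + 4)))) ≤
        2 * π / c * 2 ^ 2 * 1 := by gcongr
    refine (add_le_add (add_le_add h1 h2) h3).trans (le_of_eq ?_)
    ring
  -- `exp(−(c/8)√log x) ≥ 1/2`
  set E : ℝ := Real.exp (-(c / 8) * Real.sqrt (Real.log x)) with hE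
  have hE2 : 1 / 2 ≤ E := by
    rw [hE, ← hL, ← hlam]
    have h1 : -(1 / 4) ≤ -(c / 8) * lam := by nlinarith
    have h2 := Real.add_one_le_exp (-(c / 8) * lam)
    linarith
  have hxinv1 : x⁻¹ ≤ 1 := inv_le_one_of_one_le₀ hx
  have hK0 : 0 ≤ B * (C₀ + 1 / ρ) := by positivity
  have h1 : B * (C₀ + 1 / ρ) * (20 * x ^ (1 / 2 : ℝ) * (1 : ℝ) ^ (-(1 / 2 : ℝ)) +
      2 * x ^ (1 / 2 : ℝ) * Real.log (1 + 4) / (1 : ℝ) ^ 2 +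
      2 * π / c * Real.log (1 + 4) ^ 2 * x ^ (-(c / (2 * Real.log (1 + 4))))) + B / ρ * x⁻¹ ≤
      B * (C₀ + 1 / ρ) * (24 * Real.exp 2 + 8 * π / c) + B / ρ * 1 := by gcongr
  refine h1.trans ?_
  have h2 : B * (C₀ + 1 / ρ) * (24 * Real.exp 2 + 8 * π / c) + B / ρ * 1 =
      ((C₀ + 1 / ρ) * (48 * Real.exp 2 + 16 * π / c) + 2 / ρ) * B * (1 / 2) := by ring
  rw [h2]
  have hmono : (C₀ + 1 / ρ) * (48 * Real.exp 2 + 16 * π / c) + 2 / ρ ≤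
      (C₀ + 1 / ρ) * (48 * Real.exp 2 + 16 * π / c + 2048 * π / c ^ 3 + 24 * Real.exp 1) + 2 / ρ := by
    have h3 : 0 ≤ 2048 * π / c ^ 3 + 24 * Real.exp 1 := by positivity
    have h4 : 48 * Real.exp 2 + 16 * π / c ≤
        48 * Real.exp 2 + 16 * π / c + 2048 * π / c ^ 3 + 24 * Real.exp 1 := by linarith
    have h5 : 0 ≤ C₀ + 1 / ρ := by positivity
    exact add_le_add (mul_le_mul_of_nonneg_left h4 h5) le_rfl
  have hpos : 0 ≤ (C₀ + 1 / ρ) * (48 * Real.exp 2 + 16 * π / c + 2048 * π / c ^ 3 + 24 * Real.exp 1) +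
      2 / ρ := by positivity
  calc ((C₀ + 1 / ρ) * (48 * Real.exp 2 + 16 * π / c) + 2 / ρ) * B * (1 / 2)
      ≤ ((C₀ + 1 / ρ) * (48 * Real.exp 2 + 16 * π / c + 2048 * π / c ^ 3 + 24 * Real.exp 1) +
          2 / ρ) * B * (1 / 2) := by gcongr
    _ ≤ _ := by gcongr

/-- **Logarithmic Riesz means of the coefficients of `H(s)/ζ_K(s)`** (the standard Perron-formula
evaluation with the classical zero-free region of the Dedekind zeta function; e.g. D. R. Heath-Brown,
*Primes represented by `x³ + 2y³`*, Acta Math. 186 (2001), p. 51 (the sum `Σ` of (8.7)) and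
pp. 62–63 (the sum `Σ₁`): "the Perron formula shows that
`Σ = (1/2πi)∫_{1−i∞}^{1+i∞} f(s+1) x^s s^{−2} ds` … using the standard zero-free region for `ζ_K(s)`
we may therefore change the path of integration in the usual way to obtain
`Σ = res{f(s+1)x^s s^{−2} : s = 0} + O(exp{−c√(log x)})`").
Let `K` be a number field with `ρ_K = res_{s=1} ζ_K(s)`, and `σ_h < 1`. There are `c > 0` and
`C > 0` (depending on `K` and `σ_h` only) such that: for all coefficient sequences `a, h : ℕ → ℂ`
and `B` with `∑ |h(n)| n^{−σ_h} ≤ B`, `∑ |a(n)| n^{−σ} < ∞` for `σ > 1`, and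
`L(a, s)·ζ_K(s) = L(h, s)` for `Re s > 1` (i.e. `∑ a(n) n^{-s} = H(s)/ζ_K(s)`, `H(s) = ∑ h(n)n^{-s}`
absolutely convergent on `Re s ≥ σ_h`), and for all `x ≥ 1`,
`|∑_{n ≤ x} (a(n)/n) log(x/n) − H(1)/ρ_K| ≤ C · B · exp(−c √(log x))`
(the residue of `H(s+1)ζ_K(s+1)^{-1} x^s s^{-2}` at `s = 0` is `H(1)/ρ_K`). Inputs: Perron's formula
for logarithmic means (`LogRieszMean.sum_mul_log_eq_integral_LSeries`), the contour shift
`PerronShift.norm_integral_le`, and `‖1/ζ_K‖ ≪ log(|t|+4)` in the classical region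
(`dedekindZeta₁_classicalRegion_bounds`). [cite: HeathBrownActa2001, §8 p. 51 and §10 pp. 62–63]
[cite: MontgomeryVaughan2007, Theorem 6.7 and §6.2] -/
theorem logRieszMean_LSeries_div_dedekindZeta_bound {σₕ : ℝ} (hσₕ : σₕ < 1) :
    ∃ c : ℝ, 0 < c ∧ ∃ C : ℝ, 0 < C ∧ ∀ (a h : ℕ → ℂ) (B : ℝ),
      LSeriesSummable h σₕ → (∑' n, ‖term h σₕ n‖ ≤ B) →
      (∀ σ : ℝ, 1 < σ → LSeriesSummable a σ) →
      (∀ s : ℂ, 1 < s.re → LSeries a s * _root_.NumberField.dedekindZeta K s = LSeries h s) →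
      ∀ x : ℝ, 1 ≤ x →
        ‖(∑ n ∈ Finset.Icc 1 ⌊x⌋₊, a n / n * (Real.log (x / n) : ℂ)) -
            LSeries h 1 / (_root_.NumberField.dedekindZeta_residue K : ℂ)‖ ≤
          C * B * Real.exp (-c * Real.sqrt (Real.log x)) := by
  obtain ⟨c₀, hc₀, C₀, hC₀, hG⟩ := dedekindZeta₁_classicalRegion_bounds K
  set ρ : ℝ := _root_.NumberField.dedekindZeta_residue K with hρdef
  have hρ : 0 < ρ := _root_.NumberField.dedekindZeta_residue_pos K
  set c : ℝ := min c₀ (min (1 - σₕ) (1 / 2)) with hcdef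
  have hc : 0 < c := lt_min hc₀ (lt_min (by linarith) (by norm_num))
  have hcc₀ : c ≤ c₀ := min_le_left _ _
  have hcδ : c ≤ 1 - σₕ := (min_le_right _ _).trans (min_le_left _ _)
  have hc2 : c ≤ 1 / 2 := (min_le_right _ _).trans (min_le_right _ _)
  set A : ℝ := 48 * Real.exp 2 + 16 * π / c + 2048 * π / c ^ 3 + 24 * Real.exp 1 with hAdef
  set Cf : ℝ := (C₀ + 1 / ρ) * A + 2 / ρ with hCfdef
  have hCf0 : 0 < Cf := by positivity
  refine ⟨c / 8, by positivity, Cf, hCf0, ?_⟩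
  intro a h B hh hhB ha hrel x hx
  have hx0 : 0 < x := by linarith
  have hB : 0 ≤ B := le_trans (tsum_nonneg fun n ↦ norm_nonneg _) hhB
  obtain ⟨hΦd, hΦeq, hΦb, hΨ0, hΨ0b, hGne⟩ :=
    logRieszMean_psi_phi_package K hC₀ hG hh hhB hc hcc₀ hcδ hc2
  set G : ℂ → ℂ := ζ₁[K] with hGdef
  set Ψ : ℂ → ℂ := fun s ↦ LSeries h (1 + s) / G (1 + s) with hΨdef
  set Φ : ℂ → ℂ := fun s ↦ dslope Ψ 0 s + Ψ 0 / (s + 1) with hΦdef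
  set M : ℝ := B * (C₀ + 1 / ρ) with hMdef
  have hM0 : 0 ≤ M := by positivity
  -- the Dirichlet series `L(a, 1+s) = Ψ(s)·s` on vertical lines `Re s = κ > 0`
  have hΨline : ∀ κ : ℝ, 0 < κ → ∀ t : ℝ,
      LSeries a (1 + ((κ : ℂ) + t * I)) = Ψ ((κ : ℂ) + t * I) * ((κ : ℂ) + t * I) := by
    intro κ hκ0 t
    set s : ℂ := (κ : ℂ) + t * I with hsdef
    have hs0 : s ≠ 0 := LogRieszMean.line_ne_zero hκ0 t
    have hw : 1 < (1 + s).re := by simp [hsdef]; linarith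
    have hζ : _root_.NumberField.dedekindZeta K (1 + s) ≠ 0 :=
      dedekindZeta_ne_zero_of_one_lt_re K hw
    have hGw : G (1 + s) = s * _root_.NumberField.dedekindZeta K (1 + s) := by
      rw [hGdef, dedekindZeta₁_eq_mul_dedekindZeta hw]; ring
    have hrel' := hrel (1 + s) hw
    show LSeries a (1 + s) = LSeries h (1 + s) / G (1 + s) * s
    rw [hGw]
    field_simp
    rw [← hrel']
  have hΦline : ∀ κ : ℝ, 0 < κ → ∀ t : ℝ,
      Φ ((κ : ℂ) + t * I) = Ψ ((κ : ℂ) + t * I) / ((κ : ℂ) + t * I) -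
        Ψ 0 / (((κ : ℂ) + t * I) * (((κ : ℂ) + t * I) + 1)) := fun κ hκ0 t ↦
    hΦeq _ (LogRieszMean.line_ne_zero hκ0 t) fun h0 ↦ by
      have := congrArg Complex.re h0; simp at this; linarith
  -- the estimate with free parameters `κ`, `T`
  have hmain : ∀ κ : ℝ, 0 < κ → κ ≤ 1 / 2 → ∀ T : ℝ, 1 ≤ T →
      ‖(∑ n ∈ Finset.Ioc 0 ⌊x⌋₊, a n / n * (Real.log (x / n) : ℂ)) - Ψ 0‖ ≤
        M * (20 * x ^ κ * T ^ (-(1 / 2 : ℝ)) + 2 * x ^ κ * Real.log (T + 4) / T ^ 2 +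
          2 * π / c * Real.log (T + 4) ^ 2 * x ^ (-(c / (2 * Real.log (T + 4))))) +
        B / ρ * x⁻¹ := by
    intro κ hκ0 hκ2 T hT
    have ha' : LSeriesSummable a ((1 : ℂ) + κ) := by
      have := ha (1 + κ) (by linarith); push_cast at this; exact this
    obtain ⟨hsum, hint⟩ := logRieszMean_eq_integral_add hx0 hκ0 ha' (hΨline κ hκ0) (hΦline κ hκ0)
    have hPS := PerronShift.norm_integral_le (Θ := fun s ↦ (x : ℂ) ^ s * Φ s) hc hc2 hM0 hx
      (fun s ↦ rfl) hΦd hΦb hκ0 hκ2 hT hint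
    have hmax : max (1 - x⁻¹) 0 = 1 - x⁻¹ :=
      max_eq_left (by have := inv_le_one_of_one_le₀ hx; linarith)
    rw [hmax] at hsum
    have heq : (∑ n ∈ Finset.Ioc 0 ⌊x⌋₊, a n / n * (Real.log (x / n) : ℂ)) - Ψ 0 =
        (1 / (2 * π) : ℂ) * (∫ t : ℝ, (x : ℂ) ^ ((κ : ℂ) + t * I) * Φ (κ + t * I)) -
          Ψ 0 * (x⁻¹ : ℝ) := by
      rw [hsum]; push_cast; ring
    rw [heq]
    have h2π : ‖(1 / (2 * π) : ℂ)‖ ≤ 1 := by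
      rw [show (1 / (2 * π) : ℂ) = ((1 / (2 * π) : ℝ) : ℂ) by push_cast; ring, Complex.norm_real,
        Real.norm_eq_abs, abs_of_pos (by positivity), div_le_one (by positivity)]
      linarith [Real.two_le_pi]
    have hxinv : ‖((x⁻¹ : ℝ) : ℂ)‖ = x⁻¹ := by
      rw [Complex.norm_real, Real.norm_of_nonneg (inv_nonneg.2 hx0.le)]
    calc ‖(1 / (2 * π) : ℂ) * (∫ t : ℝ, (x : ℂ) ^ ((κ : ℂ) + t * I) * Φ (κ + t * I)) -
          Ψ 0 * (x⁻¹ : ℝ)‖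
        ≤ ‖(1 / (2 * π) : ℂ) * (∫ t : ℝ, (x : ℂ) ^ ((κ : ℂ) + t * I) * Φ (κ + t * I))‖ +
          ‖Ψ 0 * (x⁻¹ : ℝ)‖ := norm_sub_le _ _
      _ ≤ 1 * (M * (20 * x ^ κ * T ^ (-(1 / 2 : ℝ)) + 2 * x ^ κ * Real.log (T + 4) / T ^ 2 +
          2 * π / c * Real.log (T + 4) ^ 2 * x ^ (-(c / (2 * Real.log (T + 4)))))) +
          B / ρ * x⁻¹ := by
          rw [norm_mul, norm_mul, hxinv]
          gcongr
      _ = _ := by rw [one_mul]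
  -- rewrite the statement and conclude
  have hIcc : Finset.Icc 1 ⌊x⌋₊ = Finset.Ioc 0 ⌊x⌋₊ := by
    ext n; simp only [Finset.mem_Icc, Finset.mem_Ioc]; omega
  rw [hIcc, show LSeries h 1 / (ρ : ℂ) = Ψ 0 from hΨ0.symm]
  by_cases hxe : Real.exp 4 ≤ x
  · have hL4 : 4 ≤ Real.log x := by
      rw [← Real.log_exp 4]; exact Real.log_le_log (Real.exp_pos 4) hxe
    have hLpos : 0 < Real.log x := by linarith
    have hκ0 : 0 < 1 / Real.log x := by positivity
    have hκ2 : 1 / Real.log x ≤ 1 / 2 := (one_div_le_one_div hLpos (by norm_num)).2 (by linarith)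
    have hT1 : 1 ≤ Real.exp (Real.sqrt (Real.log x)) := Real.one_le_exp (Real.sqrt_nonneg _)
    exact (hmain _ hκ0 hκ2 _ hT1).trans (logRieszMean_endgame_large hc hc2 hC₀ hρ hB hxe)
  · push Not at hxe
    exact (hmain (1 / 2) (by norm_num) le_rfl 1 le_rfl).trans (logRieszMean_endgame_small hc hc2 hC₀ hρ hB hx hxe)

end NumberField

end Literature.NumberTheory.LFunctions

end
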